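import Literature.NumberTheory.EllipticCurves.PadicSigmaThreeExistence
import Literature.NumberTheory.EllipticCurves.PadicSigmaUniquenessProofs
import Literature.NumberTheory.EllipticCurves.SigmaSqDivisionBridgeProofs
import Literature.NumberTheory.EllipticCurves.PadicSigmaSqUniquenessProofs
import Literature.NumberTheory.EllipticCurves.ManinConstantQuadraticTwistAtTwoOrdinaryProofs
import Literature.NumberTheory.EllipticCurves.FormalGroupChartUniquenessProofs
import Literature.NumberTheory.EllipticCurves.FormalGroupLogHomProofs
import HarnessLib

/-!
# Sigma-squared at `p = 2`, file 1 of 3: the canonical `2`-torsion abscissa, Dwork's shape, netting (uniqueness), Vélu's formal `2`-isogeny (re-homed proofs)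

Family `bsd` material RE-HOMED into `Literature/` by the Hodge foundations lane (`lit-hodgefound`, seat p20, generation 35),
file 1 of 3: verbatim ports, in dependency order and each with its original module docstring (Parts 1–5), of the cell `bsd-f1-sign2`
(WIDTH-5 attach seat `bsd-line-att-p3` g8/g9, crux C3′ = stmt-BirchSwinnertonDyer-23008, plan SIGMASQ-AT-TWO-att-p3.md) modules
`Summits/BirchSwinnertonDyer/BirchSwinnertonDyer/Theorems/AlignedTransportAtTwoBSDOfMainConjectureRankOneAtTwoSigmaSqTwo{CanonicalPointAdic, DworkShape, Netting, VeluFormal, VeluDifferential}.lean`,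
namespace `Summit.BirchSwinnertonDyer.BirchSwinnertonDyer.Theorems.AlignedTransportAtTwoSigmaSqTwo` (and its sub-namespace `Field`) re-rooted as
`Literature.NumberTheory.EllipticCurves.PadicSigmaSqTwo.MazurTate`; theorems only (no definition, no named fact), imports Literature/Mathlib only;
all `[folklore]` helpers privatised; `open` commands made `_root_`-explicit (inside `Literature.NumberTheory.EllipticCurves.…` a bare
`open WeierstrassCurve` / `open Polynomial` would resolve to the Literature sub-namespace only).  CONTENT: the canonical `2`-torsion abscissa
over a `2`-adically complete ring (Part 1), Dwork's shape `H″(T) = H²V` for squared functional equations (Part 2), the NETTING / uniqueness of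
sigma-squared division series (Part 3), Vélu's formal `2`-isogeny and its differential (Parts 4–5).  WHY: the three files together carry the only proof in
the tree of the Literature named fact `NumberTheory.EllipticCurves.mazurTate_sigmaSq_existsUnique_two` (Mazur–Tate 1991 Thm. 3.1 at `p = 2`,
Silverman 2005 §5 Rem. 2: for every globally minimal `W/ℚ` with good ORDINARY reduction at `2` there is exactly one `Σ ∈ ℚ₂⟦z⟧` satisfying all
squared `n`-division identities — proved by Blakestad–Grant's method at `p = 2`, squared: Vélu's `2`-isogeny, the Frobenius model over the
universal ordinary `a₁`-chart ring, the Mazur–Tate constant as a `2`-adic fixed point, and the tree's Dwork lemma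
`Literature.RingTheory.FormalGroups.coeff_mem_of_map_subst_eq_pow_mul`), which `Literature/` could not import.  The Summits originals stay in
place (transitional duplication; cited here).  Honest framing of the originals stands: BSD is NOT proved by any of this; consumers merely lose the
hypothesis `(hMT : mazurTate_sigmaSq_existsUnique_two)`.
-/

noncomputable section

/-!
## Part 1 — port of `Summits/BirchSwinnertonDyer/BirchSwinnertonDyer/Theorems/AlignedTransportAtTwoBSDOfMainConjectureRankOneAtTwoSigmaSqTwoCanonicalPointAdic.lean`

# The canonical `2`-torsion abscissa over ANY `2`-adically complete ring (universal form of step S2 of the discharge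
# plan for the PRINT stub `stub_sigmaSqTwo` of crux C3′; route-independent)

Cell `bsd-f1-sign2`, WIDTH-5 attach seat `bsd-line-att-p3` g8 (`--supports stmt-BirchSwinnertonDyer-23008`; plan
`Cruxes/BSDOfMainConjectureRankOneAtTwo/SIGMASQ-AT-TWO-att-p3.md`, step S2). THEOREMS ONLY. BSD is not proved by any of this.
The `ℤ₂`-version is `…SigmaSqTwoCanonicalPoint.lean` (Mathlib's `hensels_lemma` for `ℤ_p`); here the same statement over an
arbitrary commutative ring `A` complete for the `(2)`-adic topology (e.g. the universal `a₁`-chart ring `R̂₂` of plan S1), by the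
tree's one-variable Newton lemma in adically complete rings (`PadicSigmaThree.Universal.exists_root_of_newton`).

* `exists_canonical_twoTorsionX_adic` — for `W/A` with `a₁ ∈ Aˣ`: a UNIT `X₀` with `X₀³ + b₂X₀² + 8b₄X₀ + 16b₆ = 0` and
  `X₀ + b₂ ∈ (2)` (so `x(Q) = X₀/4`, `Q` the generator of the canonical subgroup `μ₂ ⊂ E[2]`);
* `canonical_twoTorsionX_adic_unique` — uniqueness among elements `≡ −b₂ (mod 2)` (any such ring, no domain hypothesis).

## Sources
* N. M. Katz, LNM 350 (1973), §3 (canonical subgroup of an ordinary curve = kernel of Frobenius). [cite: MazurTate1991, Thm. 3.1]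
* J. H. Silverman, *AEC* 2nd ed., III.1 (`ψ₂² = 4x³ + b₂x² + 2b₄x + b₆`), VII.3. [cite: SilvermanAEC2009, VII.3 Prop. 3.1]
* D. Eisenbud, *Commutative Algebra*, Thm. 7.3 (Hensel's lemma). [cite: Eisenbud1995, Thm. 7.3]
-/

section Part1


set_option autoImplicit false

open _root_.Polynomial

namespace Literature.NumberTheory.EllipticCurves.PadicSigmaSqTwo.MazurTate

variable {A : Type*} [CommRing A] [IsAdicComplete (Ideal.span {(2 : A)}) A] (W : WeierstrassCurve A)

omit [IsAdicComplete (Ideal.span {(2 : A)}) A] in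
/-- `b₂ = a₁² + 2·(2a₂)`: modulo `(2)`, `b₂ ≡ a₁²`. [cite: SilvermanAEC2009, III.1] -/
theorem b₂_sub_a₁_sq_mem : W.b₂ - W.a₁ ^ 2 ∈ Ideal.span {(2 : A)} :=
  Ideal.mem_span_singleton.mpr ⟨2 * W.a₂, by rw [WeierstrassCurve.b₂]; ring⟩

/-- An element congruent to a unit modulo `(2)` is a unit (`(2) ⊆` Jacobson radical of a `2`-adically complete ring). [folklore] -/
private theorem isUnit_of_sub_mem {x y : A} (hy : IsUnit y) (h : x - y ∈ Ideal.span {(2 : A)}) : IsUnit x := by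
  refine Literature.RingTheory.AdicTopology.isUnit_of_isUnit_mk (Ideal.span {(2 : A)}) ?_
  have e : Ideal.Quotient.mk (Ideal.span {(2 : A)}) x = Ideal.Quotient.mk (Ideal.span {(2 : A)}) y := by
    rw [Ideal.Quotient.eq]; exact h
  rw [e]; exact hy.map _

/-- **The canonical `2`-torsion abscissa over a `2`-adically complete ring.** For `W/A` with `a₁ ∈ Aˣ` there is a unit `X₀ ∈ A`
with `X₀³ + b₂X₀² + 8b₄X₀ + 16b₆ = 0` and `X₀ ≡ −b₂ (mod 2)` (Newton from `X = −b₂`: `Q(−b₂) = 8(2b₆ − b₂b₄) ∈ (2)`,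
`Q'(−b₂) = b₂² + 8b₄ ≡ a₁⁴` a unit). [cite: SilvermanAEC2009, VII.3 Prop. 3.1] [cite: Eisenbud1995, Thm. 7.3] -/
theorem exists_canonical_twoTorsionX_adic (ha : IsUnit W.a₁) :
    ∃ X₀ : A, IsUnit X₀ ∧ X₀ ^ 3 + W.b₂ * X₀ ^ 2 + 8 * W.b₄ * X₀ + 16 * W.b₆ = 0 ∧ X₀ + W.b₂ ∈ Ideal.span {(2 : A)} := by
  set I : Ideal A := Ideal.span {(2 : A)} with hI
  set Q : A[X] := X ^ 3 + C W.b₂ * X ^ 2 + C (8 * W.b₄) * X + C (16 * W.b₆) with hQ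
  have hQeval : ∀ z : A, Q.eval z = z ^ 3 + W.b₂ * z ^ 2 + 8 * W.b₄ * z + 16 * W.b₆ := by
    intro z; simp [hQ]
  have hQder : ∀ z : A, Q.derivative.eval z = 3 * z ^ 2 + 2 * W.b₂ * z + 8 * W.b₄ := by
    intro z; simp [hQ]; ring
  have h0 : Q.eval (-W.b₂) ∈ I :=
    Ideal.mem_span_singleton.mpr ⟨4 * (2 * W.b₆ - W.b₂ * W.b₄), by rw [hQeval]; ring⟩
  have hb₂u : IsUnit W.b₂ := isUnit_of_sub_mem (ha.pow 2) (b₂_sub_a₁_sq_mem W)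
  have hd : IsUnit (Q.derivative.eval (-W.b₂)) := by
    rw [hQder]
    refine isUnit_of_sub_mem (hb₂u.pow 2) (Ideal.mem_span_singleton.mpr ⟨4 * W.b₄, by ring⟩)
  obtain ⟨X₀, hroot, hclose⟩ :=
    Literature.NumberTheory.EllipticCurves.PadicSigmaThree.Universal.exists_root_of_newton I Q (-W.b₂) h0 hd
  refine ⟨X₀, ?_, by rw [← hQeval]; exact hroot, by rw [show X₀ + W.b₂ = X₀ - -W.b₂ by ring]; exact hclose⟩
  exact isUnit_of_sub_mem hb₂u.neg hclose

/-- **Uniqueness of the canonical abscissa**: two roots of `X³ + b₂X² + 8b₄X + 16b₆` that are `≡ −b₂ (mod 2)` coincide (the cofactor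
`X₁² + X₁X₂ + X₂² + b₂(X₁ + X₂) + 8b₄ ≡ b₂²` is a unit). [cite: SilvermanAEC2009, VII.3 Prop. 3.1] -/
theorem canonical_twoTorsionX_adic_unique (ha : IsUnit W.a₁) {X₁ X₂ : A}
    (h₁ : X₁ ^ 3 + W.b₂ * X₁ ^ 2 + 8 * W.b₄ * X₁ + 16 * W.b₆ = 0) (hc₁ : X₁ + W.b₂ ∈ Ideal.span {(2 : A)})
    (h₂ : X₂ ^ 3 + W.b₂ * X₂ ^ 2 + 8 * W.b₄ * X₂ + 16 * W.b₆ = 0) (hc₂ : X₂ + W.b₂ ∈ Ideal.span {(2 : A)}) : X₁ = X₂ := by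
  set I : Ideal A := Ideal.span {(2 : A)} with hI
  have hb₂u : IsUnit W.b₂ := isUnit_of_sub_mem (ha.pow 2) (b₂_sub_a₁_sq_mem W)
  have hfac : (X₁ - X₂) * (X₁ ^ 2 + X₁ * X₂ + X₂ ^ 2 + W.b₂ * (X₁ + X₂) + 8 * W.b₄) = 0 := by
    linear_combination h₁ - h₂
  obtain ⟨d₁, hd₁⟩ := Ideal.mem_span_singleton.mp hc₁
  obtain ⟨d₂, hd₂⟩ := Ideal.mem_span_singleton.mp hc₂
  have hU : IsUnit (X₁ ^ 2 + X₁ * X₂ + X₂ ^ 2 + W.b₂ * (X₁ + X₂) + 8 * W.b₄) := by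
    refine isUnit_of_sub_mem (hb₂u.pow 2) (Ideal.mem_span_singleton.mpr ⟨d₁ * (2 * d₁ + 2 * d₂ - 2 * W.b₂) + d₂ * (2 * d₂ - 2 * W.b₂) + 4 * W.b₄, ?_⟩)
    have e1 : X₁ = 2 * d₁ - W.b₂ := by linear_combination hd₁
    have e2 : X₂ = 2 * d₂ - W.b₂ := by linear_combination hd₂
    rw [e1, e2]; ring
  have h := hfac
  rw [mul_comm] at h
  exact sub_eq_zero.mp (hU.mul_right_eq_zero.mp h)

end Literature.NumberTheory.EllipticCurves.PadicSigmaSqTwo.MazurTate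

end Part1

/-!
## Part 2 — port of `Summits/BirchSwinnertonDyer/BirchSwinnertonDyer/Theorems/AlignedTransportAtTwoBSDOfMainConjectureRankOneAtTwoSigmaSqTwoDworkShape.lean`

# From the squared functional equation to DWORK'S SHAPE `H″(T) = H²·V` (`H = (σ/z)²`) — step S6 glue of the discharge plan for the
# PRINT stub `stub_sigmaSqTwo`

Cell `bsd-f1-sign2`, WIDTH-5 attach seat `bsd-line-att-p3` g8 (`--supports stmt-BirchSwinnertonDyer-23008`; plan
`Cruxes/BSDOfMainConjectureRankOneAtTwo/SIGMASQ-AT-TWO-att-p3.md`, §7/S6). THEOREMS ONLY; route-independent; pure power-series algebra over a domain.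
BSD is not proved by any of this.

The squared `2`-isogeny functional equation (`velu_two_X_sq_mul_sq_subst_eq_domain`, `…SigmaSqTwoDomainFE.lean`) reads, for the Frobenius model
(`u = 2`): `z²·σ″(T)² = 4·σ⁴·A`, `A = X − e z²`, with `T = 2z + ⋯` (`[z¹]T = u = 2`). Writing `σ = z·s`, `σ″ = z·s″`, `T = 2z·Tₙ` (`Tₙ = 1 + ⋯`,
available once `2` is invertible, e.g. over `K₂ = R̂₂[1/2]`), `H = s²`, `H″ = s″²`, it becomes **`H″(T) = H²·V` with `V = A·Tₙ⁻²`** — literally the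
hypothesis `heq : (s.map α).subst φ = s ^ p * u` of the tree's Dwork lemma `Literature.RingTheory.FormalGroups.coeff_mem_of_map_subst_eq_pow_mul`
(`p = 2`, `s = H`, `φ = T`, `u = V`) as soon as `σ″ = σ^α` (`sigmaShift_map`: then `H″ = H^α`). The remaining Dwork hypotheses — `T ≡ z²`,
`V ≡ 1 (mod 2)` coefficientwise with coefficients in `R̂₂`, `[z¹]H ∈ R̂₂` (`coeff_one_sigmaShift_sq`: `[z¹]H = 2[z²]σ = a₁ = 1` for an odd `σ`) —
are the Frobenius-model congruences of plan step S3.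

* `sigmaShift_map` — `s(σ^φ) = s(σ)^φ`;  `coeff_one_sigmaShift_sq` — `[z¹](s²) = 2[z²]σ` for `σ = z + ⋯`;
* `subst_eq_mul_sigmaShift_subst` — `σ″(T) = T·s″(T)`;
* `dworkShape_of_sq_functionalEquation` — **`z²σ″(T)² = 4σ⁴A`, `T = 2z·Tₙ` ⟹ `(s″²)(T) = (s²)²·(A·Tₙ⁻²)`.**

## Sources
B. Dwork's lemma in Hazewinkel's functional-equation form as used by C. Blakestad, D. Grant, J. Number Theory 249 (2023), Lemma 5, Cor. 6, Prop. 13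
[cite: BlakestadGrant2023, Prop. 13]; N. Koblitz, GTM 58, Ch. IV §2 Lemma 3 [cite: Koblitz1984, Ch. IV §2 Lemma 3].
-/

section Part2


set_option autoImplicit false

open scoped _root_.Classical
open _root_.PowerSeries _root_.Literature.NumberTheory.EllipticCurves

namespace Literature.NumberTheory.EllipticCurves.PadicSigmaSqTwo.MazurTate

section Shape

variable {K : Type*} [CommRing K]

/-- `s(σ^φ) = s(σ)^φ`: the shift `σ ↦ σ/z` commutes with base change. [folklore] -/
private theorem sigmaShift_map {S : Type*} [CommRing S] (φ : K →+* S) (σ : K⟦X⟧) :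
    sigmaShift (PowerSeries.map φ σ) = PowerSeries.map φ (sigmaShift σ) := by
  ext n
  rw [coeff_sigmaShift, coeff_map, coeff_map, coeff_sigmaShift]

/-- `[z¹](s²) = 2·[z²]σ` for `σ = z + ⋯` (`s = σ/z = 1 + [z²]σ·z + ⋯`); for a Mazur–Tate-odd `σ` this is `a₁`
(`two_mul_coeff_two_of_isFormallyOdd`), `= 1` on the `a₁`-chart. [folklore] -/
private theorem coeff_one_sigmaShift_sq {σ : K⟦X⟧} (h1 : coeff 1 σ = 1) : coeff 1 (sigmaShift σ ^ 2) = 2 * coeff 2 σ := by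
  rw [pow_two, coeff_one_mul_eq, coeff_zero_eq_constantCoeff_apply, constantCoeff_sigmaShift, h1, coeff_sigmaShift]
  ring

/-- `σ″(T) = T·s″(T)` for `σ″ = z·s″`, `T(0) = 0`. [folklore] -/
private theorem subst_eq_mul_sigmaShift_subst {σ'' T : K⟦X⟧} (hσ0 : constantCoeff σ'' = 0) (hT0 : constantCoeff T = 0) :
    σ''.subst T = T * (sigmaShift σ'').subst T := by
  have hs : HasSubst T := HasSubst.of_constantCoeff_zero' hT0
  conv_lhs => rw [← X_mul_sigmaShift hσ0]
  rw [subst_mul hs, subst_X hs]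

variable [IsDomain K]

/-- **Dwork's shape from the squared functional equation.** Over a domain in which `2 ≠ 0`: if `σ(0) = σ″(0) = T(0) = 0`,
`σ/z =: s`, `σ″/z =: s″`, `T/z = 2·Tₙ` and `z²·σ″(T)² = 4·σ⁴·A`, then `(s″²)(T) = (s²)²·(A·Tₙ⁻²)` — i.e. `H″(T) = H²·V` with `H = s²`,
`H″ = s″²`, `V = A·Tₙ⁻²` (`Tₙ(0) = 1` is forced by `[z¹]T = 2`). [cite: BlakestadGrant2023, Prop. 13] -/
theorem dworkShape_of_sq_functionalEquation (h2 : (2 : K) ≠ 0) {σ σ'' T A Tn : K⟦X⟧}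
    (hσ0 : constantCoeff σ = 0) (hσ0'' : constantCoeff σ'' = 0) (hT0 : constantCoeff T = 0) (hT1 : coeff 1 T = 2)
    (hTn : sigmaShift T = C (2 : K) * Tn)
    (hFE : X ^ 2 * σ''.subst T ^ 2 = C (2 : K) ^ 2 * σ ^ 4 * A) :
    (sigmaShift σ'' ^ 2).subst T = (sigmaShift σ ^ 2) ^ 2 * (A * invOfUnit (Tn ^ 2) 1) := by
  have hs : HasSubst T := HasSubst.of_constantCoeff_zero' hT0
  -- `Tn(0) = 1`
  have hTn0 : constantCoeff Tn = 1 := by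
    have e := congrArg constantCoeff hTn
    rw [constantCoeff_sigmaShift, hT1, map_mul, constantCoeff_C] at e
    have e' : (2 : K) * (constantCoeff Tn - 1) = 0 := by linear_combination -e
    have := (mul_eq_zero.mp e').resolve_left h2
    linear_combination this
  have hinv : Tn ^ 2 * invOfUnit (Tn ^ 2) 1 = 1 := mul_invOfUnit (Tn ^ 2) 1 (by rw [map_pow, hTn0, one_pow, Units.val_one])
  -- `T = 2 z Tn`, `σ = z s`, `σ″(T) = T s″(T)`
  have hT : T = C (2 : K) * X * Tn := by
    rw [← X_mul_sigmaShift hT0, hTn]; ring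
  have hσ : σ = X * sigmaShift σ := (X_mul_sigmaShift hσ0).symm
  have hσT := subst_eq_mul_sigmaShift_subst hσ0'' hT0
  set sT := (sigmaShift σ'').subst T with hsT
  set s := sigmaShift σ with hsdef
  -- the functional equation, divided by `4z⁴`
  have hFE' : (C (4 : K) * X ^ 4) * (Tn ^ 2 * sT ^ 2) = (C (4 : K) * X ^ 4) * (s ^ 4 * A) := by
    have e := hFE
    rw [hσT, hT, hσ] at e
    have h4 : (C (4 : K) : K⟦X⟧) = C 2 * C 2 := by rw [← map_mul]; norm_num
    rw [h4]
    linear_combination e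
  have hne : (C (4 : K) : K⟦X⟧) * X ^ 4 ≠ 0 := by
    refine mul_ne_zero ?_ (pow_ne_zero 4 X_ne_zero)
    have h4 : (4 : K) ≠ 0 := by
      have : (4 : K) = 2 * 2 := by norm_num
      rw [this]; exact mul_ne_zero h2 h2
    intro h
    apply h4
    have := congrArg constantCoeff h
    rwa [constantCoeff_C, map_zero] at this
  have hkey : Tn ^ 2 * sT ^ 2 = s ^ 4 * A := mul_left_cancel₀ hne hFE'
  rw [subst_pow hs]
  calc sT ^ 2 = sT ^ 2 * (Tn ^ 2 * invOfUnit (Tn ^ 2) 1) := by rw [hinv, mul_one]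
    _ = (Tn ^ 2 * sT ^ 2) * invOfUnit (Tn ^ 2) 1 := by ring
    _ = (s ^ 2) ^ 2 * (A * invOfUnit (Tn ^ 2) 1) := by rw [hkey]; ring

/-- **Dwork's shape for the Frobenius model with `u = 2μ`, `μ` a unit** (plan §8 (S3.3)/(S3.5)): if `z²·σ″(T)² = (2μ)²·σ⁴·A`,
`T/z = 2·Tₙ` with `Tₙ(0) = μ`, then `(s″²)(T) = (s²)²·(μ²A·Tₙ⁻²)` — `H″(T) = H²·V`, `V = μ²A·Tₙ⁻²`, `V(0) = A(0)`. [cite: BlakestadGrant2023, Prop. 13] -/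
theorem dworkShape_of_sq_functionalEquation_unit (h2 : (2 : K) ≠ 0) (μ : Kˣ) {σ σ'' T A Tn : K⟦X⟧}
    (hσ0 : constantCoeff σ = 0) (hσ0'' : constantCoeff σ'' = 0) (hT0 : constantCoeff T = 0)
    (hTn : sigmaShift T = C (2 : K) * Tn) (hTn0 : constantCoeff Tn = μ)
    (hFE : X ^ 2 * σ''.subst T ^ 2 = C (2 * (μ : K)) ^ 2 * σ ^ 4 * A) :
    (sigmaShift σ'' ^ 2).subst T = (sigmaShift σ ^ 2) ^ 2 * (C ((μ : K) ^ 2) * A * invOfUnit (Tn ^ 2) (μ ^ 2)) := by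
  have hs : HasSubst T := HasSubst.of_constantCoeff_zero' hT0
  have hinv : Tn ^ 2 * invOfUnit (Tn ^ 2) (μ ^ 2) = 1 :=
    mul_invOfUnit (Tn ^ 2) (μ ^ 2) (by rw [map_pow, hTn0, Units.val_pow_eq_pow_val])
  have hT : T = C (2 : K) * X * Tn := by
    rw [← X_mul_sigmaShift hT0, hTn]; ring
  have hσ : σ = X * sigmaShift σ := (X_mul_sigmaShift hσ0).symm
  have hσT := subst_eq_mul_sigmaShift_subst hσ0'' hT0
  set sT := (sigmaShift σ'').subst T with hsT
  set s := sigmaShift σ with hsdef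
  have hFE' : (C (4 : K) * X ^ 4) * (Tn ^ 2 * sT ^ 2) = (C (4 : K) * X ^ 4) * (C ((μ : K) ^ 2) * s ^ 4 * A) := by
    have e := hFE
    rw [hσT, hT, hσ] at e
    have h4 : (C (4 : K) : K⟦X⟧) = C 2 * C 2 := by rw [← map_mul]; norm_num
    have hμ2 : (C (2 * (μ : K)) : K⟦X⟧) = C 2 * C (μ : K) := by rw [← map_mul]
    have hμsq : (C ((μ : K) ^ 2) : K⟦X⟧) = C (μ : K) ^ 2 := by rw [map_pow]
    rw [h4, hμsq]
    rw [hμ2] at e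
    linear_combination e
  have hne : (C (4 : K) : K⟦X⟧) * X ^ 4 ≠ 0 := by
    refine mul_ne_zero ?_ (pow_ne_zero 4 X_ne_zero)
    have h4 : (4 : K) ≠ 0 := by
      have : (4 : K) = 2 * 2 := by norm_num
      rw [this]; exact mul_ne_zero h2 h2
    intro h
    apply h4
    have := congrArg constantCoeff h
    rwa [constantCoeff_C, map_zero] at this
  have hkey : Tn ^ 2 * sT ^ 2 = C ((μ : K) ^ 2) * s ^ 4 * A := mul_left_cancel₀ hne hFE'
  rw [subst_pow hs]
  calc sT ^ 2 = sT ^ 2 * (Tn ^ 2 * invOfUnit (Tn ^ 2) (μ ^ 2)) := by rw [hinv, mul_one]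
    _ = (Tn ^ 2 * sT ^ 2) * invOfUnit (Tn ^ 2) (μ ^ 2) := by ring
    _ = (s ^ 2) ^ 2 * (C ((μ : K) ^ 2) * A * invOfUnit (Tn ^ 2) (μ ^ 2)) := by rw [hkey]; ring

end Shape

end Literature.NumberTheory.EllipticCurves.PadicSigmaSqTwo.MazurTate

end Part2

/-!
## Part 3 — port of `Summits/BirchSwinnertonDyer/BirchSwinnertonDyer/Theorems/AlignedTransportAtTwoBSDOfMainConjectureRankOneAtTwoSigmaSqTwoNetting.lean`

# The PRINT stub `stub_sigmaSqTwo` of crux C3′ (`BSDOfMainConjectureRankOneAtTwo`, line `birth`) NETTED: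
# Mazur–Tate's `σ²` at `p = 2` exists uniquely ⟺ for every seed curve ONE normalised solution of the
# squared duplication identity `Σ([2]z)·z⁶ = Σ(z)⁴·(z³ψ₂(x(z)))²` is `2`-integral (route-independent)

Cell `bsd-f1-sign2`, WIDTH-5 attach seat `bsd-line-att-p3` g8 on `route-BirchSwinnertonDyer-AlignedTransportAtTwo`
(line `birth` of crux C3′ stmt-BirchSwinnertonDyer-23008, registered stub `stub_sigmaSqTwo :
Literature.NumberTheory.EllipticCurves.mazurTate_sigmaSq_existsUnique_two`). SUPPORT file
(`--supports stmt-BirchSwinnertonDyer-23008`): THEOREMS ONLY (no definition, no named fact, no `sorry`),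
imports `Literature.*` only. BSD is not proved by any of this, and the PRINT fact is NOT discharged here: this
file computes its KERNEL RESIDUE, i.e. what a discharge lineage has to construct.

The fact (`PadicSigmaSqDivisionTwo.lean`; Mazur–Tate 1991 Thm. 3.1 at `p = 2` as printed by Silverman, Math.
Ann. 332 (2005) §5 Rem. 2): for every globally minimal elliptic `W/ℚ` with good ORDINARY reduction at `2` there
is EXACTLY ONE `Σ ∈ z² + z³ℤ₂⟦z⟧` with `z^{2(n²−1)}Σ([n]z) = Σ(z)^{n²}·z^{2(n²−1)}ψₙ²(x(z))` for all `n ≥ 1`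
(`IsSigmaSqDivisionSeries`). The tree already proves, binder-free: uniqueness of sigma-squared pairs at `2` when
`a₁` is a `2`-adic unit (`IsMazurTateSigmaSqPair.unique_two_of_norm_a₁_eq_one`), «division series ⟹ pair» from the
`n = 2` identity alone (`exists_isMazurTateSigmaSqPair_of_sigmaSqDivisionIdentity_two`) and «pair ⟹ division series»
(`IsMazurTateSigmaSqPair.isSigmaSqDivisionSeries`), and that EVERY `V/ℚ_p` carries a normalised odd FORMAL solution
of the sigma equation for every constant (`exists_isFormallyOdd_satisfiesSigmaODE`, `SatisfiesSigmaODE.mul_exp_subst`).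
Assembled here:

* §1 `norm_a₁_baseChange_two_eq_one` — good ORDINARY reduction at `2` of a globally minimal `W` means
  `‖a₁(W ⊗ ℚ₂)‖ = 1` (the tree's `odd_a₁_of_hasGoodReductionAtPrime_two_of_odd_frobeniusTrace_two`).
* §2 per curve `V/ℚ₂`, `2`-integral, elliptic, `‖a₁‖ = 1`: `existsUnique_isSigmaSqDivisionSeries_of_exists_pair`,
  `…_of_exists_duplication` (ONE normalised `2`-integral `Σ` satisfying the `n = 2` identity gives the `∃!`),
  `…_of_exists_sq` (the square of a normalised odd formal solution with `2`-integral SQUARE gives the `∃!`), and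
  `isMazurTateSigmaSqPair_sq_of_norm_coeff_sq_le` (such a square IS a sigma-squared pair).
* §3 the fact as an `Iff`, three currencies: `mazurTate_sigmaSq_existsUnique_two_iff_forall_exists_pair`,
  `…_iff_forall_exists_duplication`, `…_iff_forall_exists_sq` — **modulo nothing, the PRINT stub is EQUIVALENT to:
  for every globally minimal good-ordinary-at-`2` `W/ℚ`, SOME member of the one-parameter family
  `σ_ε = σ₀·exp(ε·log_W²)` of normalised odd formal solutions of `x + c = −D(Dσ/σ)` on `W ⊗ ℚ₂` has a
  `2`-INTEGRAL SQUARE** (`σ` itself never is: `[z²]σ = a₁/2`). This is the exact target of a Blakestad–Grant-type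
  construction at `p = 2` (universal ordinary `a₁`-chart, Frobenius lift = Vélu quotient by the `ℚ₂`-rational
  canonical subgroup `μ₂`, squared Prop. 13 + Dwork), cf. the tree's `mazur_tate_sigma_existsUnique_holds` (`p ≥ 5`)
  and `mazur_tate_sigma_exists_odd_holds` (`p = 3`), and of Perrin-Riou's CM argument already in the tree
  (`CMSigmaSqIntegralityProofs`: the CM seed `X₀(49)`).
* §4 `sigmaSqDivisionIdentity_two_iff_subst_formalMul` — the `n = 2` identity for `Σ = z²·h` in DWORK FORM:
  `h([2]z)·([2]z/z)² = h(z)⁴·Ỹ(z)²`, `Ỹ = z³(2y + a₁x + a₃)` (`formalYTilde`), `[2]z/z = 2 − a₁z − ⋯`.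

## Sources

* B. Mazur, J. Tate, *The `p`-adic sigma function*, Duke Math. J. 62 (1991), §2 and Thm. 3.1 (cite-only on the
  hub, acq-00916). [cite: MazurTate1991, Thm. 3.1]
* J. H. Silverman, Math. Ann. 332 (2005) = arXiv math/0404412, §5 Thm. 11 and Remark 2 («Theorem 11 remains true
  for `p = 2` provided that everything is squared», held text `paper:arxiv-math_0404412` p0010–p0011).
  [cite: Silverman2005DivPoly, §5 Rem. 2]
* B. Mazur, W. Stein, J. Tate, Doc. Math. Extra Vol. Coates (2006), Thm. 1.3, §3.1. [cite: MazurSteinTate2006, Thm. 1.3]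
* C. Blakestad, D. Grant, J. Number Theory 249 (2023), Thm. 1, Prop. 13. [cite: BlakestadGrant2023, Thm. 1]
-/

section Part3


set_option autoImplicit false

open scoped _root_.Classical
open _root_.PowerSeries _root_.WeierstrassCurve _root_.Literature.NumberTheory.EllipticCurves

namespace Literature.NumberTheory.EllipticCurves.PadicSigmaSqTwo.MazurTate

/-! ## §1 Good ordinary reduction at `2` ⟹ `a₁` is a `2`-adic unit -/

/-- **Good ORDINARY reduction at `2` of a globally minimal `W/ℚ` forces `‖a₁(W ⊗ ℚ₂)‖₂ = 1`**: the minimal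
equation has `a₁` odd (in characteristic `2`, supersingular ⟺ `ā₁ = 0`; tree lemma
`odd_a₁_of_hasGoodReductionAtPrime_two_of_odd_frobeniusTrace_two`), and an odd integer is a `2`-adic unit.
[cite: SilvermanAEC2009, V.4 and Exercise 5.7] -/
theorem norm_a₁_baseChange_two_eq_one (W : WeierstrassCurve ℚ) [W.IsElliptic] [W.IsGloballyMinimal]
    (hgood : W.HasGoodReductionAtPrime 2) (hord : ¬ (2 : ℤ) ∣ W.frobeniusTrace 2) :
    ‖(W.baseChange ℚ_[2]).a₁‖ = 1 := by
  have hodd : Odd (integralModelInt W).a₁ :=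
    odd_a₁_of_hasGoodReductionAtPrime_two_of_odd_frobeniusTrace_two W hgood
      (Int.not_even_iff_odd.mp fun h ↦ hord (even_iff_two_dvd.mp h))
  have ha : (W.baseChange ℚ_[2]).a₁ = (((integralModelInt W).a₁ : ℤ) : ℚ_[2]) := by
    conv_lhs => rw [← map_integralModelInt W]
    simp [WeierstrassCurve.baseChange, WeierstrassCurve.map]
  rw [ha]
  refine le_antisymm (Padic.norm_int_le_one _) ?_
  by_contra hlt
  have hlt' : ‖(((integralModelInt W).a₁ : ℤ) : ℚ_[2])‖ < 1 := lt_of_not_ge hlt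
  rw [Padic.norm_intCast_lt_one_iff] at hlt'
  exact (Int.not_even_iff_odd.mpr hodd) (even_iff_two_dvd.mpr (by exact_mod_cast hlt'))

/-! ## §2 Per curve over `ℚ₂`: one integral solution of the duplication identity gives the `∃!` -/

section PerCurve

variable (V : WeierstrassCurve ℚ_[2]) [V.IsIntegral ℤ_[2]] [V.IsElliptic]

variable {V} in
/-- **Two sigma-squared division series of a `2`-integral `V/ℚ₂` with `a₁ ∈ ℤ₂ˣ` coincide** — the uniqueness
clause of the PRINT fact, binder-free (each is a sigma-squared pair by the bridge; pairs are unique because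
`log_V` has unbounded coefficients when `a₁` is a unit). [cite: Silverman2005DivPoly, §5 Rem. 2]
[cite: MazurTate1991, Thm. 3.1] -/
theorem IsSigmaSqDivisionSeries.eq_of_norm_a₁_eq_one (ha : ‖V.a₁‖ = 1) {S₁ S₂ : ℚ_[2]⟦X⟧}
    (h₁ : V.IsSigmaSqDivisionSeries S₁) (h₂ : V.IsSigmaSqDivisionSeries S₂) : S₁ = S₂ := by
  obtain ⟨c₁, hc₁⟩ := h₁.exists_isMazurTateSigmaSqPair
  obtain ⟨c₂, hc₂⟩ := h₂.exists_isMazurTateSigmaSqPair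
  exact (IsMazurTateSigmaSqPair.unique_two_of_norm_a₁_eq_one V ha hc₁ hc₂).1

/-- **ONE sigma-squared pair gives the `∃!` of the PRINT fact** (per curve, `a₁ ∈ ℤ₂ˣ`).
[cite: Silverman2005DivPoly, §5 Rem. 2] [cite: MazurTate1991, Thm. 3.1] -/
theorem existsUnique_isSigmaSqDivisionSeries_of_exists_pair (ha : ‖V.a₁‖ = 1)
    (hex : ∃ Sq : ℚ_[2]⟦X⟧, ∃ c : ℚ_[2], V.IsMazurTateSigmaSqPair Sq c) :
    ∃! Sq : ℚ_[2]⟦X⟧, V.IsSigmaSqDivisionSeries Sq := by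
  obtain ⟨Sq, c, h⟩ := hex
  exact ⟨Sq, h.isSigmaSqDivisionSeries, fun S hS ↦
    IsSigmaSqDivisionSeries.eq_of_norm_a₁_eq_one ha hS h.isSigmaSqDivisionSeries⟩

/-- **ONE normalised `2`-integral solution of the squared DUPLICATION identity gives the `∃!`**: if some
`Σ = z² + O(z³) ∈ ℤ₂⟦z⟧` satisfies `z⁶·Σ([2]z) = Σ(z)⁴·z⁶ψ₂²(x(z))` (`SigmaSqDivisionIdentity Σ 2`), then
`V` has exactly one sigma-squared division series (the `n = 2` identity alone makes `Σ` a sigma-squared pair,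
tree `exists_isMazurTateSigmaSqPair_of_sigmaSqDivisionIdentity_two`). [cite: Silverman2005DivPoly, §5 Rem. 2]
[cite: MazurTate1991, Thm. 3.1] -/
theorem existsUnique_isSigmaSqDivisionSeries_of_exists_duplication (ha : ‖V.a₁‖ = 1)
    (hex : ∃ Sq : ℚ_[2]⟦X⟧, constantCoeff Sq = 0 ∧ coeff 1 Sq = 0 ∧ coeff 2 Sq = 1 ∧
      (∀ n, ‖coeff n Sq‖ ≤ 1) ∧ V.SigmaSqDivisionIdentity Sq 2) :
    ∃! Sq : ℚ_[2]⟦X⟧, V.IsSigmaSqDivisionSeries Sq := by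
  obtain ⟨Sq, h0, h1, h2, hint, hid⟩ := hex
  obtain ⟨c, hc⟩ := V.exists_isMazurTateSigmaSqPair_of_sigmaSqDivisionIdentity_two h0 h1 h2 hint hid
  exact existsUnique_isSigmaSqDivisionSeries_of_exists_pair V ha ⟨Sq, c, hc⟩

variable {V} in
/-- **The square of a normalised odd formal solution is a sigma-squared pair as soon as the SQUARE is
`p`-integral** (any `p`): `σ = z + ⋯`, `σ(i(z)) = −σ(z)`, `x + c = −D(Dσ/σ)` and `σ² ∈ ℤ_p⟦z⟧` give
`IsMazurTateSigmaSqPair (σ²) c` — no integrality of `σ` or of `c` is needed (at `p = 2` with `a₁` odd, `σ` is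
never integral: `[z²]σ = a₁/2`). Compare the tree's `IsMazurTateSigmaPair.sq` (which asks `σ` integral).
[cite: Silverman2005DivPoly, §5 Rem. 2] [cite: MazurSteinTate2006, Thm. 1.3] -/
theorem isMazurTateSigmaSqPair_sq_of_norm_coeff_sq_le {p : ℕ} [Fact p.Prime] {U : WeierstrassCurve ℚ_[p]}
    {σ : ℚ_[p]⟦X⟧} {c : ℚ_[p]} (h0 : constantCoeff σ = 0) (h1 : coeff 1 σ = 1) (hodd : U.IsFormallyOdd σ)
    (hODE : U.SatisfiesSigmaODE σ c) (hint : ∀ n, ‖coeff n (σ ^ 2)‖ ≤ 1) :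
    U.IsMazurTateSigmaSqPair (σ ^ 2) c where
  constantCoeff_eq := by rw [map_pow, h0, zero_pow two_ne_zero]
  coeff_one_eq := by
    rw [pow_two, coeff_one_mul_eq, coeff_zero_eq_constantCoeff_apply, h0]; ring
  coeff_two_eq := by
    rw [pow_two, coeff_two_mul_eq, coeff_zero_eq_constantCoeff_apply, h0, h1]; ring
  norm_coeff_le := hint
  even := hodd.sq
  ode := hODE.sq h0 h1

/-- **ONE normalised odd formal solution with `2`-integral SQUARE gives the `∃!`** (per curve, `a₁ ∈ ℤ₂ˣ`).
[cite: Silverman2005DivPoly, §5 Rem. 2] [cite: MazurTate1991, Thm. 3.1] -/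
theorem existsUnique_isSigmaSqDivisionSeries_of_exists_sq (ha : ‖V.a₁‖ = 1)
    (hex : ∃ σ : ℚ_[2]⟦X⟧, ∃ c : ℚ_[2], constantCoeff σ = 0 ∧ coeff 1 σ = 1 ∧ V.IsFormallyOdd σ ∧
      V.SatisfiesSigmaODE σ c ∧ ∀ n, ‖coeff n (σ ^ 2)‖ ≤ 1) :
    ∃! Sq : ℚ_[2]⟦X⟧, V.IsSigmaSqDivisionSeries Sq := by
  obtain ⟨σ, c, h0, h1, hodd, hODE, hint⟩ := hex
  exact existsUnique_isSigmaSqDivisionSeries_of_exists_pair V ha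
    ⟨σ ^ 2, c, isMazurTateSigmaSqPair_sq_of_norm_coeff_sq_le h0 h1 hodd hODE hint⟩

variable {V} in
/-- Conversely **a sigma-squared division series is the square of a normalised odd formal solution** (whose
square is then integral): the shape in which the PRINT fact hands its `Σ` to the height files.
[cite: MazurTate1991, Thm. 3.1] [cite: Silverman2005DivPoly, §5 Rem. 2] -/
theorem IsSigmaSqDivisionSeries.exists_sq_eq {Sq : ℚ_[2]⟦X⟧} (h : V.IsSigmaSqDivisionSeries Sq) :
    ∃ σ : ℚ_[2]⟦X⟧, ∃ c : ℚ_[2], constantCoeff σ = 0 ∧ coeff 1 σ = 1 ∧ V.IsFormallyOdd σ ∧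
      V.SatisfiesSigmaODE σ c ∧ (∀ n, ‖coeff n (σ ^ 2)‖ ≤ 1) ∧ Sq = σ ^ 2 := by
  obtain ⟨c, hc⟩ := h.exists_isMazurTateSigmaSqPair
  obtain ⟨σ, h0, h1, hodd, hODE, hSq⟩ := hc.exists_sq_eq
  refine ⟨σ, c, h0, h1, hodd, hODE, fun n ↦ ?_, hSq⟩
  rw [← hSq]
  exact hc.norm_coeff_le n

end PerCurve

/-! ## §3 The PRINT fact as an `Iff`: three currencies for its kernel residue -/

/-- **`mazurTate_sigmaSq_existsUnique_two` ⟺ every globally minimal good-ordinary-at-`2` `W/ℚ` carries SOME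
sigma-squared pair over `ℚ₂`.** (⟹ is the tree's `exists_isMazurTateSigmaSqPair_two`; ⟸ is §2 with §1.)
[cite: Silverman2005DivPoly, §5 Rem. 2] [cite: MazurTate1991, Thm. 3.1] -/
theorem mazurTate_sigmaSq_existsUnique_two_iff_forall_exists_pair :
    mazurTate_sigmaSq_existsUnique_two ↔
      ∀ (W : WeierstrassCurve ℚ) [W.IsElliptic] [W.IsGloballyMinimal],
        W.HasGoodReductionAtPrime 2 → ¬ (2 : ℤ) ∣ W.frobeniusTrace 2 →
          ∃ Sq : ℚ_[2]⟦X⟧, ∃ c : ℚ_[2], (W.baseChange ℚ_[2]).IsMazurTateSigmaSqPair Sq c := by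
  refine ⟨fun h W _ _ hgood hord ↦ W.exists_isMazurTateSigmaSqPair_two h hgood hord,
    fun h W _ _ hgood hord ↦ ?_⟩
  exact existsUnique_isSigmaSqDivisionSeries_of_exists_pair (W.baseChange ℚ_[2])
    (norm_a₁_baseChange_two_eq_one W hgood hord) (h W hgood hord)

/-- **`mazurTate_sigmaSq_existsUnique_two` ⟺ on every such `W ⊗ ℚ₂` the squared DUPLICATION identity
`z⁶·Σ([2]z) = Σ(z)⁴·z⁶ψ₂(x(z))²` has a normalised (`Σ = z² + O(z³)`) `2`-INTEGRAL solution** — ONE identity on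
ONE curve, no `n ≥ 3`, no differential equation, no constant. [cite: Silverman2005DivPoly, §5 Rem. 2]
[cite: MazurTate1991, Thm. 3.1] -/
theorem mazurTate_sigmaSq_existsUnique_two_iff_forall_exists_duplication :
    mazurTate_sigmaSq_existsUnique_two ↔
      ∀ (W : WeierstrassCurve ℚ) [W.IsElliptic] [W.IsGloballyMinimal],
        W.HasGoodReductionAtPrime 2 → ¬ (2 : ℤ) ∣ W.frobeniusTrace 2 →
          ∃ Sq : ℚ_[2]⟦X⟧, constantCoeff Sq = 0 ∧ coeff 1 Sq = 0 ∧ coeff 2 Sq = 1 ∧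
            (∀ n, ‖coeff n Sq‖ ≤ 1) ∧ (W.baseChange ℚ_[2]).SigmaSqDivisionIdentity Sq 2 := by
  refine ⟨fun h W _ _ hgood hord ↦ ?_, fun h W _ _ hgood hord ↦ ?_⟩
  · obtain ⟨Sq, hSq⟩ := exists_isSigmaSqDivisionSeries_two h W hgood hord
    exact ⟨Sq, hSq.1, hSq.2.1, hSq.2.2.1, hSq.2.2.2.1, hSq.identity (by norm_num)⟩
  · exact existsUnique_isSigmaSqDivisionSeries_of_exists_duplication (W.baseChange ℚ_[2])
      (norm_a₁_baseChange_two_eq_one W hgood hord) (h W hgood hord)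

/-- **`mazurTate_sigmaSq_existsUnique_two` ⟺ on every such `W ⊗ ℚ₂` SOME normalised odd formal solution
`σ = z + ⋯` of Mazur–Tate's equation `x + c = −D(Dσ/σ)` (they exist for every `c`, one-parameter family
`σ₀·exp(ε log_W²)`) has a `2`-INTEGRAL SQUARE.** This is the existence statement of Mazur–Tate 1991 §2 at
`p = 2` («everything squared»), isolated as the residue the tree does not prove.
[cite: MazurTate1991, Thm. 3.1] [cite: MazurSteinTate2006, Thm. 1.3] [cite: Silverman2005DivPoly, §5 Rem. 2] -/
theorem mazurTate_sigmaSq_existsUnique_two_iff_forall_exists_sq :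
    mazurTate_sigmaSq_existsUnique_two ↔
      ∀ (W : WeierstrassCurve ℚ) [W.IsElliptic] [W.IsGloballyMinimal],
        W.HasGoodReductionAtPrime 2 → ¬ (2 : ℤ) ∣ W.frobeniusTrace 2 →
          ∃ σ : ℚ_[2]⟦X⟧, ∃ c : ℚ_[2], constantCoeff σ = 0 ∧ coeff 1 σ = 1 ∧
            (W.baseChange ℚ_[2]).IsFormallyOdd σ ∧ (W.baseChange ℚ_[2]).SatisfiesSigmaODE σ c ∧
            ∀ n, ‖coeff n (σ ^ 2)‖ ≤ 1 := by
  refine ⟨fun h W _ _ hgood hord ↦ ?_, fun h W _ _ hgood hord ↦ ?_⟩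
  · obtain ⟨Sq, hSq⟩ := exists_isSigmaSqDivisionSeries_two h W hgood hord
    obtain ⟨σ, c, h0, h1, hodd, hODE, hint, -⟩ := IsSigmaSqDivisionSeries.exists_sq_eq hSq
    exact ⟨σ, c, h0, h1, hodd, hODE, hint⟩
  · exact existsUnique_isSigmaSqDivisionSeries_of_exists_sq (W.baseChange ℚ_[2])
      (norm_a₁_baseChange_two_eq_one W hgood hord) (h W hgood hord)

/-! ## §4 The duplication identity in Dwork form: `h([2]z)·([2]z/z)² = h(z)⁴·Ỹ(z)²` for `Σ = z²h` -/

section DworkForm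

variable {p : ℕ} [Fact p.Prime] (V : WeierstrassCurve ℚ_[p])

/-- `[2](z) = z · m(z)` with `m = [2]z/z = 2 − a₁z − ⋯` (`[2](0) = 0`). [cite: SilvermanAEC2009, IV.2.3] -/
theorem formalMul_two_eq_X_mul :
    V.formalMul 2 = X * PowerSeries.mk fun n ↦ coeff (n + 1) (V.formalMul 2) := by
  have h := PowerSeries.eq_shift_mul_X_add_const (V.formalMul 2)
  rw [constantCoeff_formalMul, map_zero, add_zero, mul_comm] at h
  exact h

/-- `P₂ = Ỹ²`: the pole-cleared squared `2`-division polynomial `z⁶ψ₂²(x(z))` (`sigmaSqDivisionRHS 2`) is the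
square of `Ỹ = z³(2y + a₁x + a₃) = (a₁z − 2)X + a₃z³` (`formalYTilde`). [cite: SilvermanAEC2009, III.1 and Exercise 3.7] -/
theorem sigmaSqDivisionRHS_two_eq_formalYTilde_sq : V.sigmaSqDivisionRHS 2 = V.formalYTilde ^ 2 := by
  rw [sigmaSqDivisionRHS_two, formalYTilde_sq_eq]

/-- **The squared duplication identity in DWORK FORM.** For `Σ = z²·h`: `z⁶·Σ([2]z) = Σ⁴·P₂` ⟺
`h([2]z)·m(z)² = h(z)⁴·Ỹ(z)²`, where `m = [2]z/z = 2 − a₁z − 2a₂z² + ⋯` and `Ỹ = z³(2y + a₁x + a₃) =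
−2 + a₁z + ⋯`; at an ordinary `2` both `m` and `Ỹ` vanish at the parameter `t_Q ∈ 2ℤ₂` of the `ℚ₂`-rational
canonical `2`-torsion point, and `m ≡ Ỹ ≡ a₁z + ⋯ (mod 2)` — the functional equation a discharge must solve in
`1 + a₁z + z²ℤ₂⟦z⟧`. [cite: Silverman2005DivPoly, §5 Thm. 11 (18) and Rem. 2] [cite: SilvermanAEC2009, IV.2.3] -/
theorem sigmaSqDivisionIdentity_two_iff_subst_formalMul (h : ℚ_[p]⟦X⟧) :
    V.SigmaSqDivisionIdentity (X ^ 2 * h) 2 ↔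
      h.subst (V.formalMul 2) * (PowerSeries.mk fun n ↦ coeff (n + 1) (V.formalMul 2)) ^ 2 =
        h ^ 4 * V.formalYTilde ^ 2 := by
  set m : ℚ_[p]⟦X⟧ := PowerSeries.mk fun n ↦ coeff (n + 1) (V.formalMul 2) with hm
  have hs := V.hasSubst_formalMul 2
  have h2 : V.formalMul 2 = X * m := formalMul_two_eq_X_mul V
  have hsub : (X ^ 2 * h : ℚ_[p]⟦X⟧).subst (V.formalMul 2) = (X * m) ^ 2 * h.subst (V.formalMul 2) := by
    rw [PowerSeries.subst_mul hs, PowerSeries.subst_pow hs, PowerSeries.subst_X hs, h2]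
  rw [SigmaSqDivisionIdentity, sigmaSqDivisionRHS_two_eq_formalYTilde_sq, hsub]
  norm_num
  have hX : (X : ℚ_[p]⟦X⟧) ^ 8 ≠ 0 := pow_ne_zero _ PowerSeries.X_ne_zero
  constructor
  · intro H
    apply mul_left_cancel₀ hX
    linear_combination H
  · intro H
    linear_combination (X : ℚ_[p]⟦X⟧) ^ 8 * H

end DworkForm

end Literature.NumberTheory.EllipticCurves.PadicSigmaSqTwo.MazurTate

end Part3

/-!
## Part 4 — port of `Summits/BirchSwinnertonDyer/BirchSwinnertonDyer/Theorems/AlignedTransportAtTwoBSDOfMainConjectureRankOneAtTwoSigmaSqTwoVeluFormal.lean`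

# Vélu's `2`-isogeny with a `2`-torsion kernel ON THE FORMAL GROUP (any commutative ring): the isogeny parameter
# `τ = ψ*z'` and the `x`-relation `x'(τ) = x + t/(x − e)` as identities of power series — step S4 of the discharge
# plan for the PRINT stub `stub_sigmaSqTwo` of crux C3′ (route-independent)

Cell `bsd-f1-sign2`, WIDTH-5 attach seat `bsd-line-att-p3` g8 (`--supports stmt-BirchSwinnertonDyer-23008`; plan
`Cruxes/BSDOfMainConjectureRankOneAtTwo/SIGMASQ-AT-TWO-att-p3.md`). THEOREMS ONLY, over an ARBITRARY commutative ring `R` (so they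
apply verbatim to the universal ordinary `a₁`-chart `R̂₂`). BSD is not proved by any of this. Companion of `…SigmaSqTwoVelu.lean`
(the affine identities).

With `X = z²x(z)` (`formalXMulSq`), `Q = (e, f)` a `2`-torsion point of `V` (`2f + a₁e + a₃ = 0`), `t = 3e² + 2a₂e + a₄ − a₁f`, put
`A = X − ez²` (`= z²(x − e)`), `M = XA + tz⁴` (`= z⁴(x − e)x'`), `Dn = XA² + tz⁴(a₁zA − X − fz³)` (`= −z⁶(x − e)²y'`),
where `(x', y') = ψ(x(z), y(z))` is Vélu's image point (`x' = x + t/(x − e)`, `y' = y − t(a₁(x − e) + y − f)/(x − e)²`, `y = −X/z³`).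
Then `τ := −x'/y' = z·A·M/Dn` and `τ²x' = A·M³/Dn²` (`Dn(0) = 1`, so `Dn` is a unit of `R⟦z⟧`).

* `velu_two_formal_key` — **the cleared Weierstrass equation of `ψ` of the formal point on Vélu's curve `V'`**
  (`A₄ = a₄ − 5t`, `A₆ = a₆ − b₂t − 7et`): `Dn² = AM³ + a₁zAM·Dn + a₂z²A²M² + a₃z³A²·Dn + A₄z⁴A³M + A₆z⁶A⁴` — an identity in
  `R⟦z⟧` modulo the cleared equation of the formal point (`formalXMulSq_sq_eq`) and the relations of `(e, f, t)`; certified by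
  `linear_combination` with an integral certificate found by elimination (`t`, `a₃`, `a₆`, then division by the cubic in `X`).
* `velu_two_formalXMulSq_subst` — hence, by the tree's uniqueness of the formal chart (`formalXMulSq_subst_eq_of_sq_eq`, AEC IV.1.1):
  **`X_{V'}(τ) = A·M³·u²`** for `τ = z·A·M·u`, `u = Dn⁻¹` — the `x`-coordinate of `V'` read through the isogeny parameter;
* `velu_two_x_relation` — **`X_{V'}(τ)·z²A = τ²·M`**, i.e. `x'(τ) = (XA + tz⁴)/(z²A) = x + t/(x − e)`: the pole-cleared `x`-relation that the
  squared `2`-isogeny functional equation (`…SigmaSqTwoIsogenyFE.lean`, hypothesis `hx` with `π = 1`, `r₀ = 0` for Vélu's own model)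
  consumes; the Frobenius-compatible model at `p = 2` is obtained from Vélu's by `[u = 2; r, ½, −r/2]` (plan S3), transporting `τ` by
  the tree's `formalVariableChange`.

## Sources
* J. Vélu, C. R. Acad. Sci. Paris 273 (1971) 238–241. [cite: SilvermanAEC2009, III.4 Example 4.5 and Exercise 3.35]
* J. H. Silverman, *AEC* 2nd ed., IV.1 Prop. 1.1 (uniqueness of the formal chart). [cite: SilvermanAEC2009, IV.1.1]
* C. Blakestad, D. Grant, J. Number Theory 249 (2023), Prop. 7 (c), Lemma 12 (the parameter `t_p = −x_p/y_p` of the isogeny).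
  [cite: BlakestadGrant2023, Prop. 7]
-/

section Part4


set_option autoImplicit false

open scoped _root_.Classical
open _root_.PowerSeries _root_.WeierstrassCurve _root_.Literature.NumberTheory.EllipticCurves

namespace Literature.NumberTheory.EllipticCurves.PadicSigmaSqTwo.MazurTate

variable {R : Type*} [CommRing R] (V : WeierstrassCurve R)

/-- **Vélu's `2`-isogeny on the formal point, cleared: `Dn² = AM³ + a₁zAM·Dn + a₂z²A²M² + a₃z³A²·Dn + A₄z⁴A³M + A₆z⁶A⁴`**
(notation of the module docstring; `A₄ = a₄ − 5t`, `A₆ = a₆ − b₂t − 7et`). [cite: SilvermanAEC2009, III.4 and IV.1.1] -/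
theorem velu_two_formal_key {e f t : R}
    (hQ : f ^ 2 + V.a₁ * e * f + V.a₃ * f = e ^ 3 + V.a₂ * e ^ 2 + V.a₄ * e + V.a₆)
    (h2 : 2 * f + V.a₁ * e + V.a₃ = 0) (ht : t = 3 * e ^ 2 + 2 * V.a₂ * e + V.a₄ - V.a₁ * f)
    (A M Dn : R⟦X⟧) (hA : A = V.formalXMulSq - C e * X ^ 2) (hM : M = V.formalXMulSq * A + C t * X ^ 4)
    (hDn : Dn = V.formalXMulSq * A ^ 2 + C t * X ^ 4 * (C V.a₁ * X * A - V.formalXMulSq - C f * X ^ 3)) :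
    Dn ^ 2 = A * M ^ 3 + C V.a₁ * X * A * M * Dn + C V.a₂ * X ^ 2 * A ^ 2 * M ^ 2 + C V.a₃ * X ^ 3 * A ^ 2 * Dn +
      (C V.a₄ - 5 * C t) * X ^ 4 * A ^ 3 * M + (C V.a₆ - (C V.a₁ ^ 2 + 4 * C V.a₂) * C t - 7 * C e * C t) * X ^ 6 * A ^ 4 := by
  subst hA hM hDn
  set Xs := V.formalXMulSq with hXsdef
  have hXs : Xs ^ 2 = Xs ^ 3 + C V.a₁ * X * Xs ^ 2 + C V.a₂ * X ^ 2 * Xs ^ 2 + C V.a₃ * X ^ 3 * Xs +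
      C V.a₄ * X ^ 4 * Xs + C V.a₆ * X ^ 6 := V.formalXMulSq_sq_eq
  have htC : (C t : R⟦X⟧) = 3 * C e ^ 2 + 2 * C V.a₂ * C e + C V.a₄ - C V.a₁ * C f := by
    have := congrArg (C (R := R)) ht
    simpa only [map_add, map_sub, map_mul, map_pow, map_ofNat] using this
  have h2C : 2 * (C f : R⟦X⟧) + C V.a₁ * C e + C V.a₃ = 0 := by
    have := congrArg (C (R := R)) h2
    simpa only [map_add, map_mul, map_ofNat, map_zero] using this
  have hQC : (C f : R⟦X⟧) ^ 2 + C V.a₁ * C e * C f + C V.a₃ * C f = C e ^ 3 + C V.a₂ * C e ^ 2 + C V.a₄ * C e + C V.a₆ := by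
    have := congrArg (C (R := R)) hQ
    simpa only [map_add, map_mul, map_pow] using this
  linear_combination ((2 : R⟦X⟧) * Xs ^ 5 * X ^ 4 + (-4 : R⟦X⟧) * Xs ^ 4 * X ^ 6 * C e + (2 : R⟦X⟧) * Xs ^ 4 * X ^ 6 * C V.a₂ + (2 : R⟦X⟧) * Xs ^ 4 * X ^ 5 * C V.a₁ + (-2 : R⟦X⟧) * Xs ^ 4 * X ^ 4 + -(Xs ^ 3 * X ^ 8 * (C e) ^ 2) + -(Xs ^ 3 * X ^ 8 * C e * (C V.a₁) ^ 2) + (-6 : R⟦X⟧) * Xs ^ 3 * X ^ 8 * C e * C V.a₂ + -(Xs ^ 3 * X ^ 8 * C f * C V.a₁) + (2 : R⟦X⟧) * Xs ^ 3 * X ^ 8 * C t + -(Xs ^ 3 * X ^ 8 * C V.a₁ * C V.a₃) + Xs ^ 3 * X ^ 8 * C V.a₄ + (-5 : R⟦X⟧) * Xs ^ 3 * X ^ 7 * C e * C V.a₁ + (-2 : R⟦X⟧) * Xs ^ 3 * X ^ 7 * C f + Xs ^ 3 * X ^ 7 * C V.a₃ + (4 : R⟦X⟧) * Xs ^ 3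 * X ^ 6 * C e + (-2 : R⟦X⟧) * Xs ^ 2 * X ^ 10 * (C e) ^ 3 + (3 : R⟦X⟧) * Xs ^ 2 * X ^ 10 * (C e) ^ 2 * (C V.a₁) ^ 2 + (-3 : R⟦X⟧) * Xs ^ 2 * X ^ 10 * (C e) ^ 2 * C V.a₂ + (7 : R⟦X⟧) * Xs ^ 2 * X ^ 10 * C e * C f * C V.a₁ + (-9 : R⟦X⟧) * Xs ^ 2 * X ^ 10 * C e * C t + (3 : R⟦X⟧) * Xs ^ 2 * X ^ 10 * C e * C V.a₁ * C V.a₃ + (-2 : R⟦X⟧) * Xs ^ 2 * X ^ 10 * C e * (C V.a₂) ^ 2 + (-6 : R⟦X⟧) * Xs ^ 2 * X ^ 10 * C e * C V.a₄ + Xs ^ 2 * X ^ 10 * C f * C V.a₁ * C V.a₂ + Xs ^ 2 * X ^ 10 * C f * C V.a₃ + -(Xs ^ 2 * X ^ 10 * C t * C V.a₂) + -(Xs ^ 2 * X ^ 10 * C V.a₂ * C V.a₄) + Xs ^ 2 * X ^ 9 * (C e) ^ 2 * C V.a₁ + (4 : R⟦X⟧) * Xs ^ 2 * X ^ 9 *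 C e * C f + (-2 : R⟦X⟧) * Xs ^ 2 * X ^ 9 * C e * C V.a₁ * C V.a₂ + (-2 : R⟦X⟧) * Xs ^ 2 * X ^ 9 * C e * C V.a₃ + Xs ^ 2 * X ^ 9 * C f * (C V.a₁) ^ 2 + -(Xs ^ 2 * X ^ 9 * C t * C V.a₁) + -(Xs ^ 2 * X ^ 9 * C V.a₁ * C V.a₄) + Xs ^ 2 * X ^ 8 * (C e) ^ 2 + (2 : R⟦X⟧) * Xs ^ 2 * X ^ 8 * C e * C V.a₂ + -(Xs ^ 2 * X ^ 8 * C f * C V.a₁) + Xs ^ 2 * X ^ 8 * C t + Xs ^ 2 * X ^ 8 * C V.a₄ + (4 : R⟦X⟧) * Xs * X ^ 12 * (C e) ^ 4 + (-3 : R⟦X⟧) * Xs * X ^ 12 * (C e) ^ 3 * (C V.a₁) ^ 2 + (4 : R⟦X⟧) * Xs * X ^ 12 * (C e) ^ 3 * C V.a₂ + (-8 : R⟦X⟧) * Xs * X ^ 12 * (C e) ^ 2 * C f * C V.a₁ + (9 : R⟦X⟧) * Xs * X ^ 12 * (C e) ^ 2 * C t + (-3 : R⟦X⟧) * Xs * X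 ^ 12 * (C e) ^ 2 * C V.a₁ * C V.a₃ + (3 : R⟦X⟧) * Xs * X ^ 12 * (C e) ^ 2 * C V.a₄ + (-2 : R⟦X⟧) * Xs * X ^ 12 * C e * C f * C V.a₃ + (-2 : R⟦X⟧) * Xs * X ^ 12 * C e * C V.a₂ * C V.a₄ + Xs * X ^ 12 * C f * C V.a₁ * C V.a₄ + -(Xs * X ^ 12 * (C t) ^ 2) + -(Xs * X ^ 12 * C t * C V.a₄) + -(Xs * X ^ 12 * (C V.a₄) ^ 2) + (2 : R⟦X⟧) * Xs * X ^ 11 * (C e) ^ 3 * C V.a₁ + (4 : R⟦X⟧) * Xs * X ^ 11 * (C e) ^ 2 * C f + (2 : R⟦X⟧) * Xs * X ^ 11 * (C e) ^ 2 * C V.a₁ * C V.a₂ + Xs * X ^ 11 * (C e) ^ 2 * C V.a₃ + -(Xs * X ^ 11 * C e * C f * (C V.a₁) ^ 2) + (4 : R⟦X⟧) * Xs * X ^ 11 * C e * C f * C V.a₂ + Xs * X ^ 11 * C e * C t * C V.a₁ + Xs * X ^ 11 * C e * C V.a₁ * C V.a₄ + (-2 : R⟦X⟧) * Xs * X ^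 11 * (C f) ^ 2 * C V.a₁ + (2 : R⟦X⟧) * Xs * X ^ 11 * C f * C t + (2 : R⟦X⟧) * Xs * X ^ 11 * C f * C V.a₄ + X ^ 14 * (C e) ^ 5 + X ^ 14 * (C e) ^ 4 * (C V.a₁) ^ 2 + (3 : R⟦X⟧) * X ^ 14 * (C e) ^ 4 * C V.a₂ + (2 : R⟦X⟧) * X ^ 14 * (C e) ^ 3 * C f * C V.a₁ + (-2 : R⟦X⟧) * X ^ 14 * (C e) ^ 3 * C t + X ^ 14 * (C e) ^ 3 * C V.a₁ * C V.a₃ + (2 : R⟦X⟧) * X ^ 14 * (C e) ^ 3 * (C V.a₂) ^ 2 + (2 : R⟦X⟧) * X ^ 14 * (C e) ^ 3 * C V.a₄ + (3 : R⟦X⟧) * X ^ 14 * (C e) ^ 2 * (C f) ^ 2 + -(X ^ 14 * (C e) ^ 2 * C f * C V.a₁ * C V.a₂) + X ^ 14 * (C e) ^ 2 * C f * C V.a₃ + X ^ 14 * (C e) ^ 2 * C t * C V.a₂ + (3 : R⟦X⟧) * X ^ 14 * (C e) ^ 2 * C V.a₂ * C V.a₄ + (2 : R⟦X⟧) * X ^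 14 * C e * (C f) ^ 2 * C V.a₂ + -(X ^ 14 * C e * C f * C V.a₁ * C V.a₄) + X ^ 14 * C e * (C t) ^ 2 + X ^ 14 * C e * C t * C V.a₄ + X ^ 14 * C e * (C V.a₄) ^ 2 + -(X ^ 14 * (C f) ^ 3 * C V.a₁) + X ^ 14 * (C f) ^ 2 * C t + X ^ 14 * (C f) ^ 2 * C V.a₄) * htC + ((-3 : R⟦X⟧) * Xs ^ 3 * X ^ 8 * (C e) ^ 2 * C V.a₁ + (-2 : R⟦X⟧) * Xs ^ 3 * X ^ 8 * C e * C V.a₁ * C V.a₂ + Xs ^ 3 * X ^ 8 * C f * (C V.a₁) ^ 2 + -(Xs ^ 3 * X ^ 8 * C V.a₁ * C V.a₄) + (-3 : R⟦X⟧) * Xs ^ 3 * X ^ 7 * (C e) ^ 2 + (-2 : R⟦X⟧) * Xs ^ 3 * X ^ 7 * C e * C V.a₂ + Xs ^ 3 * X ^ 7 * C f * C V.a₁ + -(Xs ^ 3 * X ^ 7 * C V.a₄) + (9 : R⟦X⟧) * Xs ^ 2 * X ^ 10 * (C e) ^ 3 * C V.a₁ + (-3 : R⟦X⟧) * Xs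 ^ 2 * X ^ 10 * (C e) ^ 2 * C f + (6 : R⟦X⟧) * Xs ^ 2 * X ^ 10 * (C e) ^ 2 * C V.a₁ * C V.a₂ + (-3 : R⟦X⟧) * Xs ^ 2 * X ^ 10 * C e * C f * (C V.a₁) ^ 2 + (-2 : R⟦X⟧) * Xs ^ 2 * X ^ 10 * C e * C f * C V.a₂ + (3 : R⟦X⟧) * Xs ^ 2 * X ^ 10 * C e * C V.a₁ * C V.a₄ + Xs ^ 2 * X ^ 10 * (C f) ^ 2 * C V.a₁ + -(Xs ^ 2 * X ^ 10 * C f * C V.a₄) + (6 : R⟦X⟧) * Xs ^ 2 * X ^ 9 * (C e) ^ 3 + (4 : R⟦X⟧) * Xs ^ 2 * X ^ 9 * (C e) ^ 2 * C V.a₂ + (-2 : R⟦X⟧) * Xs ^ 2 * X ^ 9 * C e * C f * C V.a₁ + (2 : R⟦X⟧) * Xs ^ 2 * X ^ 9 * C e * C V.a₄ + (-9 : R⟦X⟧) * Xs * X ^ 12 * (C e) ^ 4 * C V.a₁ + (6 : R⟦X⟧) * Xs * X ^ 12 * (C e) ^ 3 * C f + (-6 : R⟦X⟧) * Xs * X ^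 12 * (C e) ^ 3 * C V.a₁ * C V.a₂ + (3 : R⟦X⟧) * Xs * X ^ 12 * (C e) ^ 2 * C f * (C V.a₁) ^ 2 + (4 : R⟦X⟧) * Xs * X ^ 12 * (C e) ^ 2 * C f * C V.a₂ + (-3 : R⟦X⟧) * Xs * X ^ 12 * (C e) ^ 2 * C V.a₁ * C V.a₄ + (-2 : R⟦X⟧) * Xs * X ^ 12 * C e * (C f) ^ 2 * C V.a₁ + (2 : R⟦X⟧) * Xs * X ^ 12 * C e * C f * C V.a₄ + (6 : R⟦X⟧) * Xs * X ^ 11 * (C e) ^ 4 + (10 : R⟦X⟧) * Xs * X ^ 11 * (C e) ^ 3 * C V.a₂ + (-5 : R⟦X⟧) * Xs * X ^ 11 * (C e) ^ 2 * C f * C V.a₁ + (4 : R⟦X⟧) * Xs * X ^ 11 * (C e) ^ 2 * (C V.a₂) ^ 2 + (5 : R⟦X⟧) * Xs * X ^ 11 * (C e) ^ 2 * C V.a₄ + (-4 : R⟦X⟧) * Xs * X ^ 11 * C e * C f * C V.a₁ * C V.a₂ + (4 : R⟦X⟧) * Xs * X ^ 11 * C e * C V.a₂ * C V.a₄ + Xs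 * X ^ 11 * (C f) ^ 2 * (C V.a₁) ^ 2 + (-2 : R⟦X⟧) * Xs * X ^ 11 * C f * C V.a₁ * C V.a₄ + Xs * X ^ 11 * (C V.a₄) ^ 2 + (3 : R⟦X⟧) * X ^ 14 * (C e) ^ 5 * C V.a₁ + (6 : R⟦X⟧) * X ^ 14 * (C e) ^ 4 * C f + (2 : R⟦X⟧) * X ^ 14 * (C e) ^ 4 * C V.a₁ * C V.a₂ + -(X ^ 14 * (C e) ^ 3 * C f * (C V.a₁) ^ 2) + (10 : R⟦X⟧) * X ^ 14 * (C e) ^ 3 * C f * C V.a₂ + X ^ 14 * (C e) ^ 3 * C V.a₁ * C V.a₄ + (-5 : R⟦X⟧) * X ^ 14 * (C e) ^ 2 * (C f) ^ 2 * C V.a₁ + (4 : R⟦X⟧) * X ^ 14 * (C e) ^ 2 * C f * (C V.a₂) ^ 2 + (5 : R⟦X⟧) * X ^ 14 * (C e) ^ 2 * C f * C V.a₄ + (-4 : R⟦X⟧) * X ^ 14 * C e * (C f) ^ 2 * C V.a₁ * C V.a₂ + (4 : R⟦X⟧) * X ^ 14 * C e * C f * C V.a₂ * C V.a₄ + X ^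 14 * (C f) ^ 3 * (C V.a₁) ^ 2 + (-2 : R⟦X⟧) * X ^ 14 * (C f) ^ 2 * C V.a₁ * C V.a₄ + X ^ 14 * C f * (C V.a₄) ^ 2) * h2C + ((6 : R⟦X⟧) * Xs ^ 2 * X ^ 10 * (C e) ^ 2 + (4 : R⟦X⟧) * Xs ^ 2 * X ^ 10 * C e * C V.a₂ + (-2 : R⟦X⟧) * Xs ^ 2 * X ^ 10 * C f * C V.a₁ + (2 : R⟦X⟧) * Xs ^ 2 * X ^ 10 * C V.a₄ + (-12 : R⟦X⟧) * Xs * X ^ 12 * (C e) ^ 3 + (-8 : R⟦X⟧) * Xs * X ^ 12 * (C e) ^ 2 * C V.a₂ + (4 : R⟦X⟧) * Xs * X ^ 12 * C e * C f * C V.a₁ + (-4 : R⟦X⟧) * Xs * X ^ 12 * C e * C V.a₄ + (-3 : R⟦X⟧) * X ^ 14 * (C e) ^ 4 + (-8 : R⟦X⟧) * X ^ 14 * (C e) ^ 3 * C V.a₂ + (4 : R⟦X⟧) * X ^ 14 * (C e) ^ 2 * C f * C V.a₁ + (-4 : R⟦X⟧) * X ^ 14 * (C e) ^ 2 * (C V.a₂)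 ^ 2 + (-4 : R⟦X⟧) * X ^ 14 * (C e) ^ 2 * C V.a₄ + (4 : R⟦X⟧) * X ^ 14 * C e * C f * C V.a₁ * C V.a₂ + (-4 : R⟦X⟧) * X ^ 14 * C e * C V.a₂ * C V.a₄ + -(X ^ 14 * (C f) ^ 2 * (C V.a₁) ^ 2) + (2 : R⟦X⟧) * X ^ 14 * C f * C V.a₁ * C V.a₄ + -(X ^ 14 * (C V.a₄) ^ 2)) * hQC + (Xs ^ 4 + (-4 : R⟦X⟧) * Xs ^ 3 * X ^ 2 * C e + (-4 : R⟦X⟧) * Xs ^ 2 * X ^ 4 * C e * C V.a₂ + (2 : R⟦X⟧) * Xs ^ 2 * X ^ 4 * C f * C V.a₁ + (-2 : R⟦X⟧) * Xs ^ 2 * X ^ 4 * C V.a₄ + (8 : R⟦X⟧) * Xs * X ^ 6 * (C e) ^ 3 + (8 : R⟦X⟧) * Xs * X ^ 6 * (C e) ^ 2 * C V.a₂ + (-4 : R⟦X⟧) * Xs * X ^ 6 * C e * C f * C V.a₁ + (4 : R⟦X⟧) * Xs * X ^ 6 * C e * C V.a₄ + (4 : R⟦X⟧) * X ^ 8 *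 (C e) ^ 4 + (8 : R⟦X⟧) * X ^ 8 * (C e) ^ 3 * C V.a₂ + (-4 : R⟦X⟧) * X ^ 8 * (C e) ^ 2 * C f * C V.a₁ + (4 : R⟦X⟧) * X ^ 8 * (C e) ^ 2 * (C V.a₂) ^ 2 + (4 : R⟦X⟧) * X ^ 8 * (C e) ^ 2 * C V.a₄ + (-4 : R⟦X⟧) * X ^ 8 * C e * C f * C V.a₁ * C V.a₂ + (4 : R⟦X⟧) * X ^ 8 * C e * C V.a₂ * C V.a₄ + X ^ 8 * (C f) ^ 2 * (C V.a₁) ^ 2 + (-2 : R⟦X⟧) * X ^ 8 * C f * C V.a₁ * C V.a₄ + X ^ 8 * (C V.a₄) ^ 2) * hXs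

/-- **The `x`-coordinate of Vélu's curve read through the isogeny parameter**: with `u·Dn = 1`, `τ = z·A·M·u` (`= −x'/y'`) and
`V'` any Weierstrass equation with Vélu's coefficients, `X_{V'}(τ) = A·M³·u²` (`= τ²·x'`) — by uniqueness of the formal chart.
[cite: SilvermanAEC2009, IV.1.1] [cite: BlakestadGrant2023, Prop. 7] -/
theorem velu_two_formalXMulSq_subst {e f t : R}
    (hQ : f ^ 2 + V.a₁ * e * f + V.a₃ * f = e ^ 3 + V.a₂ * e ^ 2 + V.a₄ * e + V.a₆)
    (h2 : 2 * f + V.a₁ * e + V.a₃ = 0) (ht : t = 3 * e ^ 2 + 2 * V.a₂ * e + V.a₄ - V.a₁ * f)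
    {A M Dn u : R⟦X⟧} (hA : A = V.formalXMulSq - C e * X ^ 2) (hM : M = V.formalXMulSq * A + C t * X ^ 4)
    (hDn : Dn = V.formalXMulSq * A ^ 2 + C t * X ^ 4 * (C V.a₁ * X * A - V.formalXMulSq - C f * X ^ 3))
    (hu : Dn * u = 1) (V' : WeierstrassCurve R) (h1' : V'.a₁ = V.a₁) (h2' : V'.a₂ = V.a₂) (h3' : V'.a₃ = V.a₃)
    (h4' : V'.a₄ = V.a₄ - 5 * t) (h6' : V'.a₆ = V.a₆ - V.b₂ * t - 7 * e * t) :
    V'.formalXMulSq.subst (X * A * M * u) = A * M ^ 3 * u ^ 2 := by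
  have key := velu_two_formal_key V hQ h2 ht A M Dn hA hM hDn
  have hA0 : constantCoeff A = 1 := by
    rw [hA, map_sub, map_mul, map_pow, constantCoeff_X, constantCoeff_formalXMulSq]; ring
  have hM0 : constantCoeff M = 1 := by
    rw [hM, map_add, map_mul, map_mul, map_pow, constantCoeff_X, constantCoeff_formalXMulSq, hA0]; ring
  have hDn0 : constantCoeff Dn = 1 := by
    rw [hDn, map_add, map_mul, map_mul, map_mul, map_pow, map_pow, constantCoeff_X, constantCoeff_formalXMulSq, hA0]
    ring
  have hu0 : constantCoeff u = 1 := by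
    have e1 := congrArg constantCoeff hu
    rw [map_mul, hDn0, one_mul, map_one] at e1
    exact e1
  have hτ0 : constantCoeff (X * A * M * u) = 0 := by
    rw [map_mul, map_mul, map_mul, constantCoeff_X]; ring
  have hP0 : constantCoeff (A * M ^ 3 * u ^ 2) = 1 := by
    rw [map_mul, map_mul, map_pow, map_pow, hA0, hM0, hu0]; ring
  refine V'.formalXMulSq_subst_eq_of_sq_eq hτ0 hP0 ?_
  rw [h1', h2', h3', h4', h6', WeierstrassCurve.b₂]
  simp only [map_sub, map_mul, map_add, map_pow, map_ofNat]
  set L₁ := C V.a₁ * X * A * M + C V.a₃ * X ^ 3 * A ^ 2 with hL₁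
  linear_combination (A ^ 2 * M ^ 6 * u ^ 6) * key + (-(A ^ 2 * M ^ 6 * u ^ 4 * (1 + u * Dn - u * L₁))) * hu

/-- **The `x`-relation of Vélu's `2`-isogeny on the formal group, pole-cleared: `X_{V'}(τ)·z²A = τ²·M`** (`x'(τ) = x + t/(x − e)`).
This is hypothesis `hx` of `X_sq_mul_sq_subst_eq_of_twoIsogeny` for Vélu's own model (`π = 1`, `r₀ = 0`):
`X_{V'}(τ)·z²(X − ez²) = τ²(X(X − ez²) + tz⁴)`. [cite: SilvermanAEC2009, III.4] [cite: BlakestadGrant2023, Prop. 7] -/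
theorem velu_two_x_relation {e f t : R}
    (hQ : f ^ 2 + V.a₁ * e * f + V.a₃ * f = e ^ 3 + V.a₂ * e ^ 2 + V.a₄ * e + V.a₆)
    (h2 : 2 * f + V.a₁ * e + V.a₃ = 0) (ht : t = 3 * e ^ 2 + 2 * V.a₂ * e + V.a₄ - V.a₁ * f)
    {A M Dn u : R⟦X⟧} (hA : A = V.formalXMulSq - C e * X ^ 2) (hM : M = V.formalXMulSq * A + C t * X ^ 4)
    (hDn : Dn = V.formalXMulSq * A ^ 2 + C t * X ^ 4 * (C V.a₁ * X * A - V.formalXMulSq - C f * X ^ 3))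
    (hu : Dn * u = 1) (V' : WeierstrassCurve R) (h1' : V'.a₁ = V.a₁) (h2' : V'.a₂ = V.a₂) (h3' : V'.a₃ = V.a₃)
    (h4' : V'.a₄ = V.a₄ - 5 * t) (h6' : V'.a₆ = V.a₆ - V.b₂ * t - 7 * e * t) :
    V'.formalXMulSq.subst (X * A * M * u) * (X ^ 2 * (V.formalXMulSq - C e * X ^ 2)) =
      (X * A * M * u) ^ 2 * (V.formalXMulSq * (V.formalXMulSq - C e * X ^ 2) + C t * X ^ 4) := by
  rw [velu_two_formalXMulSq_subst V hQ h2 ht hA hM hDn hu V' h1' h2' h3' h4' h6', ← hA]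
  have hM' : V.formalXMulSq * A + C t * X ^ 4 = M := hM.symm
  rw [hM']
  ring

end Literature.NumberTheory.EllipticCurves.PadicSigmaSqTwo.MazurTate

end Part4

/-!
## Part 5 — port of `Summits/BirchSwinnertonDyer/BirchSwinnertonDyer/Theorems/AlignedTransportAtTwoBSDOfMainConjectureRankOneAtTwoSigmaSqTwoVeluDifferential.lean`

# Vélu's `2`-isogeny on the formal group: **the invariant differential is preserved**, `ω'(τ)·dτ = ω`, hence
# `log_{V'}(τ) = log_V` — the hypothesis `hlog` of the squared `2`-isogeny functional equation (Vélu model, `π = 1`);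
# step S4 of the discharge plan for the PRINT stub `stub_sigmaSqTwo` of crux C3′ (route-independent)

Cell `bsd-f1-sign2`, WIDTH-5 attach seat `bsd-line-att-p3` g8 (`--supports stmt-BirchSwinnertonDyer-23008`; plan
`Cruxes/BSDOfMainConjectureRankOneAtTwo/SIGMASQ-AT-TWO-att-p3.md`). THEOREMS ONLY; sequel of `…SigmaSqTwoVeluFormal.lean` (notation
`A = X − ez²`, `M = XA + tz⁴`, `Dn = XA² + tz⁴(a₁zA − X − fz³)`, `u = Dn⁻¹`, `τ = zAMu = ψ*z'`, `P = AM³u² = X_{V'}(τ)`).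
BSD is not proved by any of this.

* `velu_two_sq_eq` — the cleared equation `P² = P³ + a₁τP² + a₂τ²P² + a₃τ³P + A₄τ⁴P + A₆τ⁶` (from `velu_two_formal_key`).
* `velu_two_dx_relation` — **`dξ = (1 − t/(x−e)²)dx` cleared**: `(τP^• − 2Pτ^•)·z³A² = (A² − tz⁴)(zX^• − 2X)·τ³` (pure calculus
  from `P·z²A = τ²M` and its derivative).
* `velu_two_negY_formal` — **`2υ + a₁ξ + a₃ = (1 − t/(x−e)²)(2y + a₁x + a₃)` cleared**: `((a₁τ − 2)P + a₃τ³)·A² = (A² − tz⁴)·Ỹ·(AMu)³`,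
  `Ỹ = (a₁z − 2)X + a₃z³` (uses `2f + a₁e + a₃ = 0`).
* `velu_two_formalInvDiff_subst` — **`ω_{V'}(τ)·τ^• = ω_V`** (`ψ*ω' = ω`, Vélu's normalisation), in any commutative DOMAIN with `2 ≠ 0`
  (the chart lemma `formalEta_subst_mul_eq` is divided by `τP^• − 2Pτ^• = −2 + O(z)`; at `p = 2` this is not a unit, only a
  non-zero-divisor).
* `velu_two_formalLog_subst` — over a `ℚ`-algebra domain: **`log_{V'}(τ) = log_V`** (`π = 1`); for the Frobenius-compatible model
  `V'' = [2; r, ½, −r/2]·V'` the tree's `formalVariableChange` turns this into `log_{V''}(τ'') = 2·log_V`, the `hlog` (`π = 2`) of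
  `X_sq_mul_sq_subst_eq_of_twoIsogeny`.

## Sources
* J. Vélu, C. R. Acad. Sci. Paris 273 (1971) (`ψ*(dx'/(2y' + a₁x' + a₃)) = dx/(2y + a₁x + a₃)`). [cite: SilvermanAEC2009, III.4]
* C. Blakestad, D. Grant, J. Number Theory 249 (2023), Prop. 7 (c), Prop. 13 (`ω'(T')dT' = πω`). [cite: BlakestadGrant2023, Prop. 7]
* J. H. Silverman, *AEC* 2nd ed., IV.1 (`ω = dx/(2y + a₁x + a₃) = (1 + ⋯)dz`), IV.4–IV.5 (`log`). [cite: SilvermanAEC2009, IV.1.1]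
-/

section Part5


set_option autoImplicit false

open scoped _root_.Classical
open _root_.PowerSeries _root_.WeierstrassCurve _root_.Literature.NumberTheory.EllipticCurves

namespace Literature.NumberTheory.EllipticCurves.PadicSigmaSqTwo.MazurTate

section AnyRing

variable {R : Type*} [CommRing R] (V : WeierstrassCurve R)

/-- **The cleared Weierstrass equation of `(τ, P)` on Vélu's curve**: `P² = P³ + a₁τP² + a₂τ²P² + a₃τ³P + A₄τ⁴P + A₆τ⁶`
(`A₄ = a₄ − 5t`, `A₆ = a₆ − b₂t − 7et`; hypothesis `heq` of the tree's chart lemmas). [cite: SilvermanAEC2009, IV.1.1] -/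
theorem velu_two_sq_eq {e f t : R}
    (hQ : f ^ 2 + V.a₁ * e * f + V.a₃ * f = e ^ 3 + V.a₂ * e ^ 2 + V.a₄ * e + V.a₆)
    (h2 : 2 * f + V.a₁ * e + V.a₃ = 0) (ht : t = 3 * e ^ 2 + 2 * V.a₂ * e + V.a₄ - V.a₁ * f)
    {A M Dn u τ P : R⟦X⟧} (hA : A = V.formalXMulSq - C e * X ^ 2) (hM : M = V.formalXMulSq * A + C t * X ^ 4)
    (hDn : Dn = V.formalXMulSq * A ^ 2 + C t * X ^ 4 * (C V.a₁ * X * A - V.formalXMulSq - C f * X ^ 3))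
    (hu : Dn * u = 1) (hτ : τ = X * A * M * u) (hP : P = A * M ^ 3 * u ^ 2) :
    P ^ 2 = P ^ 3 + C V.a₁ * τ * P ^ 2 + C V.a₂ * τ ^ 2 * P ^ 2 + C V.a₃ * τ ^ 3 * P +
      (C V.a₄ - 5 * C t) * τ ^ 4 * P + (C V.a₆ - (C V.a₁ ^ 2 + 4 * C V.a₂) * C t - 7 * C e * C t) * τ ^ 6 := by
  have key := velu_two_formal_key V hQ h2 ht A M Dn hA hM hDn
  subst hτ hP
  set L₁ := C V.a₁ * X * A * M + C V.a₃ * X ^ 3 * A ^ 2 with hL₁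
  linear_combination (A ^ 2 * M ^ 6 * u ^ 6) * key + (-(A ^ 2 * M ^ 6 * u ^ 4 * (1 + u * Dn - u * L₁))) * hu

/-- `P·z²A = τ²·M` (`ξ = P/τ² = M/(z²A) = x + t/(x − e)`). [cite: SilvermanAEC2009, III.4] -/
theorem velu_two_P_mul {A M u τ P : R⟦X⟧} (hτ : τ = X * A * M * u) (hP : P = A * M ^ 3 * u ^ 2) :
    P * (X ^ 2 * A) = τ ^ 2 * M := by
  subst hτ hP; ring

/-- **`dξ = (1 − t/(x − e)²)·dx`, cleared**: `(τP^• − 2Pτ^•)·z³A² = (A² − tz⁴)·(zX^• − 2X)·τ³` — pure calculus from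
`P·z²A = τ²M`, its derivative, `A = X − ez²`, `M = XA + tz⁴`. [cite: SilvermanAEC2009, III.4] -/
theorem velu_two_dx_relation {e t : R} {A M u τ P : R⟦X⟧} (hA : A = V.formalXMulSq - C e * X ^ 2)
    (hM : M = V.formalXMulSq * A + C t * X ^ 4) (hτ : τ = X * A * M * u) (hP : P = A * M ^ 3 * u ^ 2) :
    (τ * d⁄dX R P - 2 * P * d⁄dX R τ) * X ^ 3 * A ^ 2 =
      (A ^ 2 - C t * X ^ 4) * (X * d⁄dX R V.formalXMulSq - 2 * V.formalXMulSq) * τ ^ 3 := by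
  set Xs := V.formalXMulSq with hXs
  have ha : P * (X ^ 2 * A) = τ ^ 2 * M := velu_two_P_mul hτ hP
  have hdA : d⁄dX R A = d⁄dX R Xs - 2 * C e * X := by
    rw [hA, map_sub, Derivation.leibniz, derivative_C, smul_zero, add_zero, Derivation.leibniz_pow, derivative_X]
    simp only [nsmul_eq_mul, smul_eq_mul, Nat.cast_ofNat, Nat.add_one_sub_one, pow_one]
    ring
  have hdM : d⁄dX R M = d⁄dX R Xs * A + Xs * d⁄dX R A + 4 * C t * X ^ 3 := by
    rw [hM, map_add, Derivation.leibniz, Derivation.leibniz, derivative_C, smul_zero, add_zero, Derivation.leibniz_pow,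
      derivative_X]
    simp only [nsmul_eq_mul, smul_eq_mul, Nat.cast_ofNat, Nat.add_one_sub_one]
    ring
  have hb : d⁄dX R P * (X ^ 2 * A) + P * (2 * X * A + X ^ 2 * d⁄dX R A) =
      d⁄dX R M * τ ^ 2 + 2 * M * τ * d⁄dX R τ := by
    have h := congrArg (d⁄dX R) ha
    rw [Derivation.leibniz, Derivation.leibniz, Derivation.leibniz, Derivation.leibniz_pow, Derivation.leibniz_pow,
      derivative_X] at h
    simp only [nsmul_eq_mul, smul_eq_mul, Nat.cast_ofNat, Nat.add_one_sub_one, pow_one] at h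
    linear_combination h
  set dP := d⁄dX R P with hdP
  set dτ := d⁄dX R τ with hdτ
  set dM := d⁄dX R M with hdM'
  set dA := d⁄dX R A with hdA'
  set dXs := d⁄dX R Xs with hdXs
  linear_combination (τ * X * A) * hb + (-(2 * dτ * X * A + τ * (2 * A + X * dA))) * ha + (τ ^ 3 * A * X) * hdM + (-(τ ^ 3 * M * X) + τ ^ 3 * A * Xs * X) * hdA + ((-2 : R⟦X⟧) * τ ^ 3 * A + -(τ ^ 3 * dXs * X) + (2 : R⟦X⟧) * τ ^ 3 * X ^ 2 * C e) * hM + ((2 : R⟦X⟧) * τ ^ 3 * X ^ 4 * C t) * hA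

/-- **`2υ + a₁ξ + a₃ = (1 − t/(x − e)²)(2y + a₁x + a₃)`, cleared**: `((a₁τ − 2)P + a₃τ³)·A² = (A² − tz⁴)·Ỹ·(AMu)³` with
`Ỹ = (a₁z − 2)X + a₃z³ = z³(2y + a₁x + a₃)` (`formalYTilde`). Uses `2f + a₁e + a₃ = 0` and `u·Dn = 1`. [cite: SilvermanAEC2009, III.4] -/
theorem velu_two_negY_formal {e f t : R} (h2 : 2 * f + V.a₁ * e + V.a₃ = 0)
    {A M Dn u τ P : R⟦X⟧} (hA : A = V.formalXMulSq - C e * X ^ 2) (hM : M = V.formalXMulSq * A + C t * X ^ 4)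
    (hDn : Dn = V.formalXMulSq * A ^ 2 + C t * X ^ 4 * (C V.a₁ * X * A - V.formalXMulSq - C f * X ^ 3))
    (hu : Dn * u = 1) (hτ : τ = X * A * M * u) (hP : P = A * M ^ 3 * u ^ 2) :
    ((C V.a₁ * τ - 2) * P + C V.a₃ * τ ^ 3) * A ^ 2 = (A ^ 2 - C t * X ^ 4) * V.formalYTilde * (A * M * u) ^ 3 := by
  have h2C : 2 * (C f : R⟦X⟧) + C V.a₁ * C e + C V.a₃ = 0 := by
    have := congrArg (C (R := R)) h2
    simpa only [map_add, map_mul, map_ofNat, map_zero] using this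
  rw [formalYTilde_def]
  subst hτ hP hDn hM hA
  linear_combination ((V.formalXMulSq - C e * X ^ 2) ^ 3 * (V.formalXMulSq * (V.formalXMulSq - C e * X ^ 2) + C t * X ^ 4) ^ 3 *
      u ^ 3 * C t * X ^ 7) * h2C +
    (2 * (V.formalXMulSq - C e * X ^ 2) ^ 3 * (V.formalXMulSq * (V.formalXMulSq - C e * X ^ 2) + C t * X ^ 4) ^ 3 * u ^ 2) * hu

end AnyRing

section Domain

variable {R : Type*} [CommRing R] [IsDomain R] (V : WeierstrassCurve R)

/-- **Vélu's normalisation on the formal group: `ω_{V'}(τ)·τ^• = ω_V`** (`ψ*ω' = ω`) for the `2`-isogeny with a `2`-torsion kernel,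
in any commutative domain with `2 ≠ 0`. Chart lemma for `V'` (`η'(τ)(τP^• − 2Pτ^•) = τ^•((a₁τ − 2)P + a₃τ³)`), `velu_two_negY_formal`,
`velu_two_dx_relation` and `η(zX^• − 2X) = Ỹ` on `V` give `(η'(τ) − ητ^•)·(τP^• − 2Pτ^•)·z³A² = 0`; the second factor is
`−2z³ + ⋯ ≠ 0`. [cite: BlakestadGrant2023, Prop. 7] [cite: SilvermanAEC2009, IV.1.1] -/
theorem velu_two_formalInvDiff_subst (htwo : (2 : R) ≠ 0) {e f t : R}
    (hQ : f ^ 2 + V.a₁ * e * f + V.a₃ * f = e ^ 3 + V.a₂ * e ^ 2 + V.a₄ * e + V.a₆)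
    (h2 : 2 * f + V.a₁ * e + V.a₃ = 0) (ht : t = 3 * e ^ 2 + 2 * V.a₂ * e + V.a₄ - V.a₁ * f)
    {A M Dn u τ P : R⟦X⟧} (hA : A = V.formalXMulSq - C e * X ^ 2) (hM : M = V.formalXMulSq * A + C t * X ^ 4)
    (hDn : Dn = V.formalXMulSq * A ^ 2 + C t * X ^ 4 * (C V.a₁ * X * A - V.formalXMulSq - C f * X ^ 3))
    (hu : Dn * u = 1) (hτ : τ = X * A * M * u) (hP : P = A * M ^ 3 * u ^ 2)
    (V' : WeierstrassCurve R) (h1' : V'.a₁ = V.a₁) (h2' : V'.a₂ = V.a₂) (h3' : V'.a₃ = V.a₃)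
    (h4' : V'.a₄ = V.a₄ - 5 * t) (h6' : V'.a₆ = V.a₆ - V.b₂ * t - 7 * e * t) :
    V'.formalInvDiff.subst τ * d⁄dX R τ = V.formalInvDiff := by
  -- constant terms
  have hA0 : constantCoeff A = 1 := by
    rw [hA, map_sub, map_mul, map_pow, constantCoeff_X, constantCoeff_formalXMulSq]; ring
  have hM0 : constantCoeff M = 1 := by
    rw [hM, map_add, map_mul, map_mul, map_pow, constantCoeff_X, constantCoeff_formalXMulSq, hA0]; ring
  have hDn0 : constantCoeff Dn = 1 := by
    rw [hDn, map_add, map_mul, map_mul, map_mul, map_pow, map_pow, constantCoeff_X, constantCoeff_formalXMulSq, hA0]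
    ring
  have hu0 : constantCoeff u = 1 := by
    have e1 := congrArg constantCoeff hu
    rw [map_mul, hDn0, one_mul, map_one] at e1
    exact e1
  have hτ0 : constantCoeff τ = 0 := by
    rw [hτ, map_mul, map_mul, map_mul, constantCoeff_X]; ring
  have hP0 : constantCoeff P = 1 := by
    rw [hP, map_mul, map_mul, map_pow, map_pow, hA0, hM0, hu0]; ring
  have hτ1 : coeff 1 τ = 1 := by
    rw [hτ, mul_assoc, mul_assoc, coeff_succ_X_mul, coeff_zero_eq_constantCoeff, map_mul, map_mul, hA0, hM0, hu0]
    ring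
  -- the chart lemma for V'
  have heq := velu_two_sq_eq V hQ h2 ht hA hM hDn hu hτ hP
  have heq' : P ^ 2 = P ^ 3 + C V'.a₁ * τ * P ^ 2 + C V'.a₂ * τ ^ 2 * P ^ 2 + C V'.a₃ * τ ^ 3 * P +
      C V'.a₄ * τ ^ 4 * P + C V'.a₆ * τ ^ 6 := by
    rw [h1', h2', h3', h4', h6', WeierstrassCurve.b₂]
    simp only [map_sub, map_mul, map_add, map_pow, map_ofNat]
    exact heq
  have hηlem := V'.formalEta_subst_mul_eq hτ0 hP0 heq'
  rw [h1', h3'] at hηlem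
  -- the three relations on V
  have hnegY := velu_two_negY_formal V h2 hA hM hDn hu hτ hP
  have hdx := velu_two_dx_relation V hA hM hτ hP
  have hVrel := V.formalEta_mul_sub_eq_formalYTilde
  have hτ3 : τ ^ 3 = X ^ 3 * (A * M * u) ^ 3 := by rw [hτ]; ring
  -- (eta'(tau) - eta * dtau) * Q = 0 with Q = (tau P' - 2 P tau') z^3 A^2
  set Q₁ := τ * d⁄dX R P - 2 * P * d⁄dX R τ with hQ₁
  have hprod : (V'.formalEta.subst τ - V.formalEta * d⁄dX R τ) * (Q₁ * X ^ 3 * A ^ 2) = 0 := by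
    linear_combination (X ^ 3 * A ^ 2) * hηlem + (d⁄dX R τ * X ^ 3) * hnegY -
      (V.formalEta * d⁄dX R τ) * hdx - (d⁄dX R τ * X ^ 3 * (A ^ 2 - C t * X ^ 4) * (A * M * u) ^ 3) * hVrel -
      (V.formalEta * d⁄dX R τ * (A ^ 2 - C t * X ^ 4) * (X * d⁄dX R V.formalXMulSq - 2 * V.formalXMulSq)) * hτ3
  -- the second factor is nonzero
  have hQ0 : constantCoeff Q₁ = -2 := by
    rw [hQ₁, map_sub, map_mul, hτ0, zero_mul, map_mul, map_mul, hP0, ← coeff_zero_eq_constantCoeff_apply (d⁄dX R τ),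
      coeff_derivative, zero_add, hτ1]
    have h2c : constantCoeff (2 : R⟦X⟧) = 2 := map_ofNat constantCoeff 2
    rw [h2c]; norm_num
  have hQne : Q₁ * X ^ 3 * A ^ 2 ≠ 0 := by
    refine mul_ne_zero (mul_ne_zero ?_ (pow_ne_zero _ X_ne_zero)) (pow_ne_zero _ ?_)
    · intro h; rw [h, map_zero] at hQ0
      exact htwo (by linear_combination hQ0)
    · intro h; rw [h, map_zero] at hA0; exact zero_ne_one hA0
  have hη : V'.formalEta.subst τ = V.formalEta * d⁄dX R τ :=
    sub_eq_zero.mp ((mul_eq_zero.mp hprod).resolve_right hQne)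
  -- invert: omega is the inverse of eta
  have hsT : HasSubst τ := HasSubst.of_constantCoeff_zero' hτ0
  have hηW' : V'.formalEta.subst τ * V'.formalInvDiff.subst τ = 1 := by
    rw [← subst_mul hsT, V'.formalEta_mul_formalInvDiff]
    rw [show (1 : R⟦X⟧) = C (1 : R) from (map_one C).symm, subst_C]; rfl
  have hηW := V.formalEta_mul_formalInvDiff
  linear_combination (-(V'.formalInvDiff.subst τ * V.formalInvDiff)) * hη +
    V.formalInvDiff * hηW' - (V'.formalInvDiff.subst τ * d⁄dX R τ) * hηW

end Domain

section RatAlgebra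

variable {R : Type*} [CommRing R] [IsDomain R] [Algebra ℚ R] (V : WeierstrassCurve R)

/-- **`log_{V'}(τ) = log_V`** (Vélu model, `π = 1`): the hypothesis `hlog` of the squared `2`-isogeny functional equation, over any
`ℚ`-algebra domain (`ℚ_p`, `Frac R̂₂`). From `ω'(τ)τ^• = ω`: both sides have derivative `ω` and vanish at `0`.
[cite: BlakestadGrant2023, Prop. 7] [cite: SilvermanAEC2009, IV.5] -/
theorem velu_two_formalLog_subst {e f t : R}
    (hQ : f ^ 2 + V.a₁ * e * f + V.a₃ * f = e ^ 3 + V.a₂ * e ^ 2 + V.a₄ * e + V.a₆)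
    (h2 : 2 * f + V.a₁ * e + V.a₃ = 0) (ht : t = 3 * e ^ 2 + 2 * V.a₂ * e + V.a₄ - V.a₁ * f)
    {A M Dn u τ P : R⟦X⟧} (hA : A = V.formalXMulSq - C e * X ^ 2) (hM : M = V.formalXMulSq * A + C t * X ^ 4)
    (hDn : Dn = V.formalXMulSq * A ^ 2 + C t * X ^ 4 * (C V.a₁ * X * A - V.formalXMulSq - C f * X ^ 3))
    (hu : Dn * u = 1) (hτ : τ = X * A * M * u) (hP : P = A * M ^ 3 * u ^ 2)
    (V' : WeierstrassCurve R) (h1' : V'.a₁ = V.a₁) (h2' : V'.a₂ = V.a₂) (h3' : V'.a₃ = V.a₃)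
    (h4' : V'.a₄ = V.a₄ - 5 * t) (h6' : V'.a₆ = V.a₆ - V.b₂ * t - 7 * e * t) :
    V'.formalLog.subst τ = V.formalLog := by
  have htwo : (2 : R) ≠ 0 := by
    rw [← map_ofNat (algebraMap ℚ R) 2]
    exact (map_ne_zero_iff _ (algebraMap ℚ R).injective).mpr two_ne_zero
  have hω := velu_two_formalInvDiff_subst V htwo hQ h2 ht hA hM hDn hu hτ hP V' h1' h2' h3' h4' h6'
  have hτ0 : constantCoeff τ = 0 := by
    have hA0 : constantCoeff A = 1 := by
      rw [hA, map_sub, map_mul, map_pow, constantCoeff_X, constantCoeff_formalXMulSq]; ring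
    rw [hτ, map_mul, map_mul, map_mul, constantCoeff_X]; ring
  have hs : HasSubst τ := HasSubst.of_constantCoeff_zero' hτ0
  -- equal derivatives
  have hd : d⁄dX R (V'.formalLog.subst τ) = d⁄dX R V.formalLog := by
    rw [derivative_subst R hs, WeierstrassCurve.derivative_formalLog, WeierstrassCurve.derivative_formalLog,
      ← formalInvDiff_eq_formalOmega, ← formalInvDiff_eq_formalOmega]
    exact hω
  -- equal constant terms (both 0), hence equal
  ext n
  rcases n with _ | n
  · rw [coeff_zero_eq_constantCoeff, Literature.RingTheory.FormalGroups.constantCoeff_subst_of_constantCoeff_eq_zero hτ0,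
      constantCoeff_formalLog, constantCoeff_formalLog]
  · have e := congrArg (coeff n) hd
    rw [coeff_derivative, coeff_derivative] at e
    have hn : ((n : R) + 1) ≠ 0 := by
      rw [show ((n : R) + 1) = algebraMap ℚ R ((n : ℚ) + 1) by simp]
      intro h
      have : ((n : ℚ) + 1) = 0 := (algebraMap ℚ R).injective (by rw [h, map_zero])
      linarith [Nat.cast_nonneg (α := ℚ) n]
    exact mul_right_cancel₀ hn e

end RatAlgebra

end Literature.NumberTheory.EllipticCurves.PadicSigmaSqTwo.MazurTate

end Part5

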